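import Mathlib
import Literature.MathematicalPhysics.QuantumFieldTheory.MagnenRivasseauSeneor1993.MRS93GaussianReferenceMeasures
import Literature.MathematicalPhysics.QuantumFieldTheory.MagnenRivasseauSeneor1993.MRS93CurvatureDecomposition
import HarnessLib

/-!
# Magnen–Rivasseau–Sénéor (CMP 155, 1993): the AXIAL YANG–MILLS ACTION of the bare ansatz — (II.1)–(II.3),
# (II.9)–(II.10), (II.16)–(II.19) and the third factor `e^{(1/2)(−F²_sp(A) − ⟨A,p₀²A⟩ + Σ_i λ²⟨A,(p²κ^i(p))A⟩)}` of
# (II.78) — typed CONCRETELY on cut-off configurations of the pinned momentum-lattice carrier; (II.3), (II.9),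
# (II.16), (II.19) and «both pieces in (II.9) are obviously positive» PROVED; the printed sentence «This formula is
# still formal … (this would give back the ill-defined Lebesgue measure)» (p.332) KERNEL-CHECKED on the typed objects

statement-level skeleton of published definitions with citation tags; bookkeeping proved; nothing here is a claim
about the Yang–Mills mass gap, about continuum Yang–Mills on `T⁴` without infrared cutoff, or about the Clay problem —
and nothing of Magnen–Rivasseau–Sénéor's analysis is asserted or formalised

**Citation header (reproduction of PUBLISHED work).** J. Magnen, V. Rivasseau, R. Sénéor, *Construction of YM₄ with
an infrared cutoff*, Commun. Math. Phys. **155** (1993) 325–383 [MagnenRivasseauSeneor1993], Sect. II.A pp.328–332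
((II.1)–(II.3), (II.7), (II.9)–(II.10), (II.16)–(II.19)) and (II.78) p.347. Loci `p.NNN tl.nn` = journal page /
text-layer line of the held scan `paper:magnen1993-cmp155-mrs-ym4-infrared-cutoff` (PDF page = journal page − 324);
displays read on the decoded page images (renders of record `run/shared/lean/pub/lit-balaban/inprint/lit-balaban-p14/
renders-cmp155/p04_full_s6.png`, `p05_full_s6.png`, `p06_full_s6.png`, `p07_full_s6.png`, `p08_full_s6.png`,
`p23_full_s6.png`). Cell pub-balaban-gaps, track G3, seat mrs-lit-1 (gen 3); companion prose
`run/shared/lean/pub/pub-balaban-gaps/g3/MRS-AS-PRINTED.md` §2, §5. Builds on `…MRS93MainStatementPinned` (the pinned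
carrier `Momentum = ℤ⁴ ∖ {0}`, `Mode`, `Config`, `Parameters`), `…MRS93AnisotropicSlicing` (`Momentum.norm`),
`…MRS93GaussianReferenceMeasures` (`Parameters.invC0`, `muZero` = `dμ_{0,ρ₁}`, `realify`, `rep`, `modeGaussian`) and
`…MRS93StartingAnsatz` (`sliceCutoff` = κ^i, `tentativeCoupling` = (λ_i^t)², `Ansatz.invCaxial`).

**Why this file.** The cell's §D row 1 for MRS reads «the PREDICATE is typed as printed; the CONSTRUCTION is NOT
typed» and the gen-2 record names the frontier: of the bare ansatz (II.78) the two REFERENCE MEASURES are typed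
concretely (`muZero`, `nu`), the DENSITY factors are not — «the explicit ones would need position-space fields, i.e.
Fourier series of the lattice modes, their products and box integrals». This file types the central explicit density
factor, the axial Yang–Mills action `e^{(1/2)(−F²_sp(A) − ⟨A,p₀²A⟩ + Σ_i λ²⟨A,(p²κ^i(p))A⟩)}` (third line of (II.78);
(II.17)/(II.18)), as a genuine function `Config → ℝ` on every finite momentum WINDOW `S` (the cut-off field: under
`dμ_{0,ρ₁}` only the modes with `|p| < (3 + η⁻¹)M^{ρ₁}` are alive, `muZeroCovariance_eq_zero_of_ge`), with the products
of fields written as what they are on the torus — finite CONVOLUTIONS of Fourier coefficients — and the box integrals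
`∫_Λ d⁴x` evaluated by Parseval at unit volume (READING (P) below). On these objects the printed algebra is then
KERNEL-CHECKED: (II.3), (II.9), (II.16), (II.19), the positivity sentence p.330 tl.10, and the «still formal» sentence
p.332 tl.24–26 in its literal instance (§7).

**What the paper prints (verbatim, from the page images).**
* p.328 tl.26–29: *«We write A = Σ_{a=1}^3 A^a t_a, with t_a = (iσ_a/2) … the covariant derivative is D_μ = ∂_μ −
  λ[A_μ, ·]. We have Tr t_a t_b = −δ_ab/2. The field curvature is: F_μν = (∂_μA_ν − ∂_νA_μ) − λ[A_μ, A_ν] =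
  (∂ ∧ A − λ[A, A]), (II.1) λ being the coupling constant … in the three dimensional su(2) space, the commutator is
  a wedge product: [A^a_μ, A^b_ν] = ε^c_{ab} A^a_μ A^b_ν. The pure Yang-Mills action is: −(1/2)∫_Λ d⁴x Tr F_μν F^μν
  = (1/4)∫_Λ d⁴x Σ_a F^a_μν F^{μν a} (II.2)»*; tl.37–42 and p.329 tl.2–3: *«we define a scalar product ⟨A, B⟩ on
  space time tensors A and B of the same type with values in the Lie algebra, by the convention that a trace is
  taken over all correspondent space time indices and minus a trace over group indices, so that it is positive
  definite with a factor 1/2 in component notation. We also write simply A² for ⟨A, A⟩, and with this convention we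
  can write the action as (1/2)∫_Λ F². We distinguish between the quadratic, trilinear and quartic pieces of F²,
  writing: F² = F₂ + λF₃ + λ²F₄. (II.3)»*.
* (II.7) p.329 tl.21: *«A₀ = 0. (II.7)»*.
* p.330 tl.6–11: *«Indeed in the axial gauge we have F² = ⟨Ap₀²A⟩ + F²_sp, (II.9) where the spatial part of F² is
  by definition F_sp ≡ −(1/2)∫_Λ d⁴x Tr F_mn F^mn = (1/4)∫_Λ d⁴x Σ_a F^a_mn F^{mn,a}, (II.10) and both pieces in (II.9)
  are obviously positive. Also the piece ⟨Ap₀²A⟩ is quadratic, hence (II.9) looks almost like the usual case of a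
  positive quadratic measure and a positive interaction.»*
* p.331 tl.18–20: *«The quadratic form p₀² is not invertible when p₀ = 0 and in order to have a good propagator we
  add and subtract Σ_i(λ_i^t)²⟨A, p²κ^i(p)A⟩ to the action. We warn the reader that below we usually write λ²p²
  instead of Σ_i(λ_i^t)²p²κ^i(p) which is quite heavy.»*
* p.332 tl.3–9: *«We define Σ_i (λ_i^t)²⟨A, p²κ^i(p)A⟩ = ⟨A, C₀⁻¹A⟩. (II.16) For the moment our formal functional
  integral in the axial gauge without cutoff is: e^{(1/2)(−F²_sp − ⟨A,p₀²A⟩ + Σ_i(λ_i^t)²⟨A,(p²κ^i(p))A⟩)} dμ₀,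
  (II.17)»*; tl.16–26: *«We could write instead of (II.17) the functional measure of the theory as: dμ_{0,ρ₁}(A)
  e^{(1/2)(−F²_sp − ⟨A,p₀²A⟩ + Σ_i(λ_i^t)²⟨A,(p²κ^i(p))A⟩)} which is proportional to dμ_{axial,ρ₁}(A) e^{(1/2)(−F²_sp
  + Σ_i(λ_i^t)²⟨A,(p²κ^i(p))A⟩)}, (II.18) where dμ_{0,ρ₁} is the Gaussian measure with propagator C₀(p)κ_{ρ₁}(p), and
  the sum over i in (II.18) stops at ρ₁, and the Gaussian measure dμ_axial and propagators C_axial are obtained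
  by joining to C₀ the quadratic piece ⟨A, p₀²A⟩: ⟨A, p₀²A⟩ + Σ_i(λ_i^t)²⟨Ap²κ^i(p)A⟩ = ⟨A, C_axial⁻¹A⟩. (II.19) This
  formula is still formal, because the positive exponential cannot be integrated simply with the Gaussian
  measure dμ_{0,ρ₁} (this would give back the ill-defined Lebesgue measure). Fortunately this is also not the
  correct starting point …»*.
* (II.78) p.347 tl.2–7, third line: *«× e^{(1/2)(−F²_sp(A) − ⟨A,p₀²A⟩ + Σ_i λ²⟨A,(p²κ^i(p))A⟩)} [K_{ρ,ρ₂}(A′,γ)]⁻¹»*;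
  p.340 tl.5–6: *«most of the time we use simply the notation λ instead of λ_i^t and leave to the reader to
  reconstruct the correct value according to the frequency of the fields concerned»*.

**What is typed here (definitions with bodies; bookkeeping kernel-checked, zero `sorry`, zero named facts).**
* §1 the complex Fourier coefficient `coeff A p μ a = Ã^a_μ(p)` of a configuration (from its real/imaginary
  coordinates), its extension by zero `coeffZ S A k μ a` to all `k ∈ ℤ⁴` outside the window `S` and at the deleted
  zero mode; the axial gauge (II.7) on configurations, `IsAxial A` (every time coordinate vanishes); the canonical
  windows `window R` = all momenta with `|p| < R` (`mem_window_iff`).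
* §2 (II.1) in momentum space: `linCurv` = `(∂ ∧ A)~(k) = i(k_μ Ã_ν(k) − k_ν Ã_μ(k))`, `quadCurv` = `[A_μ, A_ν]~(k)
  = Σ_{q+r=k} Ã_μ(q) ×₃ Ã_ν(r)` (the printed wedge product, Mathlib `crossProduct`, as in `…TruncatedGauge.bracket`),
  `curvCoeff S lam A μ ν a k = F̃^a_μν(k)`; PROVED: antisymmetry, vanishing outside `convSupport S = S₀ + S₀`
  (`S₀ = S ∪ {0}`), i.e. the finite sums below ARE the complete Parseval sums.
* §3 (II.2) the action `action lam S A = (1/2)∫_Λ F² = (1/4) Σ_k Σ_{μ,ν,a} |F̃^a_μν(k)|²`, (II.10) `Fsp` (spatial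
  indices only), `⟨A, p₀²A⟩ = quadTime`; (II.3) `F2`, `F3`, `F4` (the `λ⁰, λ¹, λ²` coefficients) with
  **`action_eq_F2_F3_F4`** and the spatial analogue `Fsp_eq`; `F2_nonneg`, `F4_nonneg`, `Fsp_nonneg`,
  `quadTime_nonneg` («both pieces in (II.9) are obviously positive»).
* §4 **(II.9) PROVED**: `action_eq_quadTime_add_Fsp` — for an axial configuration, `(1/2)∫F² = ⟨A,p₀²A⟩ + F_sp` on
  every window and for every coupling.
* §5 the quadratic forms `quadForm S w A = ⟨A, w(p)A⟩ = (1/2) Σ_{p∈S} w(p) Σ_{μ,a} |Ã^a_μ(p)|²`; `quadSlices` =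
  `Σ_{i≤ρ₁} (λ_i^t)²⟨A, p²κ^i(p)A⟩` from the NAMED parameters; **(II.16) PROVED** (`quadSlices_eq_invC0`: it is
  `⟨A, C₀⁻¹A⟩` with the tree's symbol `Parameters.invC0`), **(II.19) PROVED** (`quadTime_add_quadSlices`: `= ⟨A,
  C_axial⁻¹A⟩`, and `_eq_invCaxial`: the tree's `Ansatz.invCaxial`).
* §6 the exponent of (II.17)/(II.18) and of the third line of (II.78), `bareExponent par lam ρ₁ S A = (1/2)(−F_sp −
  ⟨A,p₀²A⟩ + Σ_{i≤ρ₁}(λ_i^t)²⟨A,p²κ^iA⟩)`, and the density factor `ymFactor = exp (bareExponent …)`: positive,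
  CONTINUOUS (hence measurable) on `Config`, and `≤ exp ((1/2) quadSlices)` (the two subtracted pieces are `≥ 0`).
* §7 **p.332 tl.24–26 KERNEL-CHECKED** in its literal instance: `lintegral_exp_half_quadSlices_muZero_eq_top` — on
  any window containing a pair `±p₀` on the plateau of the fake cutoff (`κ_{ρ₁}(|p₀|) = 1`) with `C₀(p₀)⁻¹ > 0`,
  `∫ e^{(1/2)Σ_i(λ_i^t)²⟨A,p²κ^iA⟩} dμ_{0,ρ₁}(A) = +∞` (the Gaussian density and the positive exponential cancel
  EXACTLY on that mode: Lebesgue measure); `not_integrable_exp_half_quadSlices_muZero`; (v1.1)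
  `lintegral_exp_half_quadSlices_muZero_canonical_eq_top`: on the canonical window `window((3+η⁻¹)M^{ρ₁})`, for
  EVERY `ρ₁`, with no mode-level hypothesis (nonnegative squared couplings, `(λ₀^t)² > 0`; the unit spatial momentum
  is a plateau pair inside the window).
* §8 (v1.1) **p.331 tl.18–19 and p.329 tl.29–32 KERNEL-CHECKED**: the single-colour longitudinal modes `gaugeMode p e u
  v` (`Ã^a_μ(±p) = (±p)_μ e^a w`, the Fourier modes of a linearised abelian gauge transformation `A_μ = ∂_μφ` of
  `A = 0`) are exact ZERO MODES of the windowed action for every coupling (`action_gaugeMode`: `(∂∧A)~ = 0` since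
  `k_μk_ν − k_νk_μ = 0`, `[A,A]~ = 0` since `e ×₃ e = 0`); for `p₀ = 0` (time-independent, the residual invariance the
  axial condition leaves) they are axial and `⟨A,p₀²A⟩ = 0` too — `exists_axial_zeroMode`: the free axial action
  `⟨A,p₀²A⟩ + F_{2,sp}` is NOT definite («p₀² is not invertible when p₀ = 0»); and the added term cures it:
  `quadTime_add_quadSlices_gaugeMode_pos` — on these modes `⟨A, C_axial⁻¹A⟩ = C₀(p)⁻¹|p|²|e|²(u²+v²) > 0`.
* §9 (v1.1) (II.9) for the INTEGRAND, convention-free, on the pointwise jets of `…MRS93CurvatureDecomposition` (seat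
  mrs-lit-2; (II.1) = `SectIV.curvature`): `curvature_sq_axial_split` — at a point with `A₀ = 0`, `∂_νA₀ = 0`,
  `Σ_{μ,ν,a}(F^a_μν)² = 2Σ_{n,a}(∂₀A^a_n)² + Σ_{m,n,a}(F^a_mn)²` (the position-space face of READING (Q)).
* §10 (v1.2) «which is proportional to dμ_{axial,ρ₁}(A) … joining to C₀ the quadratic piece ⟨A, p₀²A⟩» (p.332
  tl.18–23) ONE MODE, kernel-checked: `gaussianReal_withDensity_exp_neg_half_mul_sq` (`𝒩(0,v)·e^{−cx²/2} =
  √(v'/v)·𝒩(0,v')`, `v'⁻¹ = v⁻¹ + c`) and `muZeroVariance_tilt_eq_axial` (on a plateau mode of `dμ_{0,ρ₁}`: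
  `C_axial⁻¹ = p₀² + C₀⁻¹`, (II.19), as a Gaussian measure); the product over the modes of a window is NOT assembled.

**Readings (declared).** (P) PARSEVAL AT UNIT VOLUME with `∂_μ ↔ i p_μ`: the print writes the symbols `p²`, `p₀²`
for `−Δ`, `−∂₀²` on the torus `Λ = ℝ⁴/ℤ⁴` with dual lattice `Λ* = ℤ⁴` and never writes a `2π` (readings (iii)/(iv)
of `…StartingAnsatz`/`…AnisotropicSlicing`: every symbol of the tree is a function of `p ∈ ℤ⁴`); accordingly
`∫_Λ d⁴x X(x)Y(x) = Σ_{k∈ℤ⁴} X̃(k) conj Ỹ(k)`, products of fields are convolutions `(XY)~(k) = Σ_{q+r=k} X̃(q)Ỹ(r)`,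
and with *«a factor 1/2 in component notation»* (p.328 tl.40) `⟨A, w(p)B⟩ = (1/2) Σ_k w(k) Σ_{μ,a} Ã^a_μ(k) conj
B̃^a_μ(k)`. A `2π` in the characters (`e^{2πik·x}` on `ℝ⁴/ℤ⁴`) would put `2πk_μ` for `k_μ` in `linCurv` and `(2π)²`
into the symbols `p₀²`, `p²` — one global convention, the one the tree's radial symbols already fix (reading (iii) of
`…StartingAnsatz`); no statement below changes shape. (Q) «F²» on the
left of (II.9) and in «(1/2)∫_Λ F²» is the ACTION (II.2) (`action`), and «F²_sp» of (II.9)/(II.17)/(II.78) is the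
«F_sp» DEFINED in (II.10) (`Fsp`) — with these identifications (II.9) holds on the nose (`action_eq_quadTime_add_Fsp`:
`(1/4)·2·Σ_{n,a}|ik₀Ã^a_n|² = (1/2)Σ p₀²|Ã|² = ⟨A,p₀²A⟩`); read instead with «F²» = `⟨F,F⟩ = 2 × action`, (II.9) would
be off by a factor 2 — the print's own «we can write the action as (1/2)∫F²» vs «F² = ⟨Ap₀²A⟩ + F²_sp» leaves this
implicit; we exhibit the reading under which the display is an identity. (R) the coupling inside `F_sp` in (II.78)
is printed «λ» (*«leave to the reader to reconstruct the correct value»*, p.340 tl.5–6): typed as a free argument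
`lam`; the coefficient of `⟨A,p²κ^iA⟩` is `(λ_i^t)²` as in (II.16)–(II.18) (the «λ²» of (II.78) is the declared
shorthand, p.331 tl.19–20). (S) WINDOWS: the functionals are typed on a finite window `S ⊆ ℤ⁴ ∖ {0}` of momenta (the
field with cutoff); the canonical choice under `dμ_{0,ρ₁}` is `window ((3 + η⁻¹)M^{ρ₁})` (all modes the reference
measure can excite), but every theorem holds for every `S`. (T) the sign convention of the wedge product is the
print's (`[X,Y]^a = ε_abc X^b Y^c`, cf. `…TruncatedGauge.tgen_commutator` for the flag that with `t_a = iσ_a/2` the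
structure constants carry the opposite sign) — it enters `F3` only, and only by a global sign.

**Honest status / what is NOT claimed.** This types ONE density factor of (II.78) — the axial Yang–Mills action with
the added-and-subtracted quadratic form — and the algebra the print states about it. NOT typed: `χ_LFR`, `G(A′,γ)`
(II.45), `K_{ρ,ρ₂}` (II.76), `CT_ρ` (III.1), `L_{0,ρ₁}F` (II.46)–(II.47), the gauge-fixing factor `e^{−(ζ/2)(∇_{B′_l}·
A′_s)²}`, the γ-damping `e^{−Σ(λ^{1/2+2ε₂}γ^i)^N}` (a position-space power of an su(2)-valued field, whose norm
convention the print leaves open), the change of variables `A = T⁻¹(A′ − U(γ))` (p.341) through which (II.78) feeds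
the action the field `A′`; nor that (II.18) or (II.78) is normalisable — on the contrary §7 proves the printed
NON-normalisability of the positive exponential against `dμ_{0,ρ₁}` (what the paper's large-field expansion, `A⁴`
counterterm and true cutoff are there to cure — none of which is typed). `ymFactor` is a function, not a measure;
no moment of MRS's theory is computed; `PinnedTheory.law` stays an assumption. Nothing here is continuum Yang–Mills
on `T⁴`, nothing lifts the infrared cutoff, nothing is about Bałaban's programme.
-/

noncomputable section

open MeasureTheory ProbabilityTheory Filter Topology Finset Complex
open scoped NNReal ENNReal ComplexConjugate Matrix

namespace Literature.MathematicalPhysics.QuantumFieldTheory.MagnenRivasseauSeneor1993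

namespace MainStatement

open Ansatz

/-! ## §1 Fourier coefficients of a configuration, the axial gauge, momentum windows -/

/-- The complex Fourier coefficient `Ã^a_μ(p) = Re Ã^a_μ(p) + i Im Ã^a_μ(p)` of a configuration, read off its
real coordinates `(p, μ, a, false/true)` (K1 of `…Pinned`). [cite: MagnenRivasseauSeneor1993, §II.A p.328 tl.12–17] -/
def coeff (A : Config) (p : Momentum) (μ : Fin 4) (a : Fin 3) : ℂ :=
  (A (p, μ, a, false) : ℂ) + (A (p, μ, a, true) : ℂ) * I

/-- `|Ã^a_μ(p)|² = (Re)² + (Im)²`. [cite: MagnenRivasseauSeneor1993, §II.A p.328] -/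
theorem normSq_coeff (A : Config) (p : Momentum) (μ : Fin 4) (a : Fin 3) :
    normSq (coeff A p μ a) = A (p, μ, a, false) ^ 2 + A (p, μ, a, true) ^ 2 := by
  unfold coeff
  exact normSq_add_mul_I _ _

/-- `Ã` as a function on ALL of `ℤ⁴`, extended by zero outside the window `S` and at the deleted zero mode
(p.328 tl.13–15: «the zero mode in Fourier space is deleted in all our functional integrals»).
[cite: MagnenRivasseauSeneor1993, §II.A p.328 tl.12–15] -/
def coeffZ (S : Finset Momentum) (A : Config) (k : Fin 4 → ℤ) (μ : Fin 4) (a : Fin 3) : ℂ :=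
  if h : k = 0 then 0 else if (⟨k, h⟩ : Momentum) ∈ S then coeff A ⟨k, h⟩ μ a else 0

/-- On the window, `coeffZ` is the coefficient. [cite: MagnenRivasseauSeneor1993, §II.A p.328] -/
theorem coeffZ_val {S : Finset Momentum} (A : Config) {p : Momentum} (hp : p ∈ S) (μ : Fin 4) (a : Fin 3) :
    coeffZ S A p.1 μ a = coeff A p μ a := by
  unfold coeffZ
  rw [dif_neg p.2, if_pos hp]

/-- Off the window (and at `k = 0`) it vanishes. [cite: MagnenRivasseauSeneor1993, §II.A p.328 tl.13–15] -/
theorem coeffZ_eq_zero {S : Finset Momentum} (A : Config) {k : Fin 4 → ℤ}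
    (hk : ∀ p ∈ S, p.1 ≠ k) (μ : Fin 4) (a : Fin 3) : coeffZ S A k μ a = 0 := by
  unfold coeffZ
  split_ifs with h hmem
  · rfl
  · exact absurd rfl (hk _ hmem)
  · rfl

/-- The zero mode carries nothing. [cite: MagnenRivasseauSeneor1993, §II.A p.328 tl.13–15] -/
@[simp] theorem coeffZ_zero (S : Finset Momentum) (A : Config) (μ : Fin 4) (a : Fin 3) :
    coeffZ S A 0 μ a = 0 := by
  unfold coeffZ
  rw [dif_pos rfl]

/-- **(II.7) on configurations**: the axial gauge `A₀ = 0` — every time coordinate vanishes («Our initial axial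
field A has only nine scalar components since A₀ was identically 0», p.342 tl.3–4).
[cite: MagnenRivasseauSeneor1993, (II.7) p.329 tl.21; p.342 tl.3–4] -/
def IsAxial (A : Config) : Prop := ∀ m : Mode, m.IsTime → A m = 0

/-- In the axial gauge the time coefficients vanish. [cite: MagnenRivasseauSeneor1993, (II.7) p.329] -/
theorem coeff_time {A : Config} (hA : IsAxial A) (p : Momentum) (a : Fin 3) : coeff A p 0 a = 0 := by
  unfold coeff
  rw [hA (p, 0, a, false) rfl, hA (p, 0, a, true) rfl]
  simp

/-- … and so do their extensions by zero. [cite: MagnenRivasseauSeneor1993, (II.7) p.329] -/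
theorem coeffZ_time {A : Config} (hA : IsAxial A) (S : Finset Momentum) (k : Fin 4 → ℤ) (a : Fin 3) :
    coeffZ S A k 0 a = 0 := by
  unfold coeffZ
  split_ifs
  · rfl
  · exact coeff_time hA _ a
  · rfl

/-- `|p|² = Σ_μ p_μ²` («p²»). [cite: MagnenRivasseauSeneor1993, (II.13) p.331 and §II.A p.328] -/
theorem Momentum.norm_sq (p : Momentum) : p.norm ^ 2 = ∑ μ, ((p.1 μ : ℤ) : ℝ) ^ 2 :=
  Real.sq_sqrt (Finset.sum_nonneg fun _ _ => sq_nonneg _)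

/-- `|−p| = |p|`. [cite: MagnenRivasseauSeneor1993, §II.A p.328] -/
theorem Momentum.norm_neg (p : Momentum) : p.neg.norm = p.norm := by
  unfold Momentum.norm
  congr 1
  exact Finset.sum_congr rfl fun μ _ => by simp

/-- A coordinate is bounded by the length: `|p_μ| ≤ |p|`. [cite: MagnenRivasseauSeneor1993, §II.A p.328] -/
theorem Momentum.abs_apply_le_norm (p : Momentum) (μ : Fin 4) : |((p.1 μ : ℤ) : ℝ)| ≤ p.norm := by
  unfold Momentum.norm
  rw [← Real.sqrt_sq_eq_abs]
  refine Real.sqrt_le_sqrt ?_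
  exact Finset.single_le_sum (f := fun ν => ((p.1 ν : ℤ) : ℝ) ^ 2) (fun ν _ => sq_nonneg _)
    (Finset.mem_univ μ)

/-- THE WINDOW of radius `R`: all lattice momenta with `|p| < R`, as a `Finset` (the modes a cutoff at scale `R`
keeps; under `dμ_{0,ρ₁}` every mode with `|p| ≥ (3 + η⁻¹)M^{ρ₁}` is dead, `muZeroCovariance_eq_zero_of_ge`).
[cite: MagnenRivasseauSeneor1993, (II.13)–(II.14) p.331, (II.18) p.332] -/
def window (R : ℝ) : Finset Momentum :=
  ((Fintype.piFinset fun _ : Fin 4 => Finset.Icc (-⌈R⌉) ⌈R⌉).subtype fun p => p ≠ 0).filter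
    fun p => p.norm < R

/-- Membership in the window is exactly `|p| < R`. [cite: MagnenRivasseauSeneor1993, (II.13) p.331] -/
theorem mem_window_iff (R : ℝ) (p : Momentum) : p ∈ window R ↔ p.norm < R := by
  unfold window
  rw [Finset.mem_filter, Finset.mem_subtype, Fintype.mem_piFinset]
  constructor
  · exact fun h => h.2
  · intro h
    refine ⟨fun μ => ?_, h⟩
    have hμ : |((p.1 μ : ℤ) : ℝ)| ≤ R := (p.abs_apply_le_norm μ).trans h.le
    have hR : R ≤ (⌈R⌉ : ℝ) := Int.le_ceil R
    have h1 : ((p.1 μ : ℤ) : ℝ) ≤ ⌈R⌉ := ((le_abs_self _).trans hμ).trans hR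
    have h2 : -(⌈R⌉ : ℝ) ≤ ((p.1 μ : ℤ) : ℝ) := by
      have := (neg_abs_le _).trans' (neg_le_neg (hμ.trans hR))
      exact this
    rw [Finset.mem_Icc]
    constructor
    · exact_mod_cast h2
    · exact_mod_cast h1

/-- Windows are symmetric under `p ↦ −p`. [cite: MagnenRivasseauSeneor1993, §II.A p.328] -/
theorem neg_mem_window_iff (R : ℝ) (p : Momentum) : p.neg ∈ window R ↔ p ∈ window R := by
  rw [mem_window_iff, mem_window_iff, Momentum.norm_neg]

/-! ## §2 (II.1) in momentum space: the curvature coefficients `F̃^a_μν(k)` on a window -/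

variable (S : Finset Momentum)

/-- The linear part of (II.1), `(∂_μA_ν − ∂_νA_μ)~(k) = i(k_μ Ã^a_ν(k) − k_ν Ã^a_μ(k))` (READING (P): `∂_μ ↔ ik_μ`).
[cite: MagnenRivasseauSeneor1993, (II.1) p.328] -/
def linCurv (A : Config) (μ ν : Fin 4) (a : Fin 3) (k : Fin 4 → ℤ) : ℂ :=
  I * (((k μ : ℤ) : ℂ) * coeffZ S A k ν a - ((k ν : ℤ) : ℂ) * coeffZ S A k μ a)

/-- The quadratic part of (II.1), `[A_μ, A_ν]~(k) = Σ_{q,r∈S, q+r=k} Ã_μ(q) ×₃ Ã_ν(r)` — the printed wedge product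
«[A^a_μ, A^b_ν] = ε^c_{ab} A^a_μ A^b_ν» (p.328 tl.33) of the Fourier coefficients, convolved (READING (P)).
[cite: MagnenRivasseauSeneor1993, (II.1) p.328 tl.30–33] -/
def quadCurv (A : Config) (μ ν : Fin 4) (k : Fin 4 → ℤ) : Fin 3 → ℂ :=
  ∑ q ∈ S, ∑ r ∈ S,
    if q.1 + r.1 = k then (fun b => coeff A q μ b) ⨯₃ (fun c => coeff A r ν c) else 0

/-- **(II.1)** `F̃^a_μν(k) = (∂ ∧ A)~ − λ([A, A])~` on the window `S`, coupling `lam`.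
[cite: MagnenRivasseauSeneor1993, (II.1) p.328] -/
def curvCoeff (lam : ℝ) (A : Config) (μ ν : Fin 4) (a : Fin 3) (k : Fin 4 → ℤ) : ℂ :=
  linCurv S A μ ν a k - (lam : ℂ) * quadCurv S A μ ν k a

/-- `(∂ ∧ A)_νμ = −(∂ ∧ A)_μν`. [cite: MagnenRivasseauSeneor1993, (II.1) p.328] -/
theorem linCurv_swap (A : Config) (μ ν : Fin 4) (a : Fin 3) (k : Fin 4 → ℤ) :
    linCurv S A ν μ a k = -linCurv S A μ ν a k := by
  unfold linCurv; ring

/-- `[A_ν, A_μ]~ = −[A_μ, A_ν]~` (anticommutativity of the wedge product, after exchanging the convolution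
variables). [cite: MagnenRivasseauSeneor1993, (II.1) p.328 tl.33] -/
theorem quadCurv_swap (A : Config) (μ ν : Fin 4) (k : Fin 4 → ℤ) :
    quadCurv S A ν μ k = -quadCurv S A μ ν k := by
  unfold quadCurv
  rw [Finset.sum_comm]
  rw [← Finset.sum_neg_distrib]
  refine Finset.sum_congr rfl fun q _ => ?_
  rw [← Finset.sum_neg_distrib]
  refine Finset.sum_congr rfl fun r _ => ?_
  by_cases h : q.1 + r.1 = k
  · have h' : r.1 + q.1 = k := by rw [add_comm]; exact h
    rw [if_pos h', if_pos h, cross_anticomm]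
  · have h' : ¬ r.1 + q.1 = k := by rw [add_comm]; exact h
    rw [if_neg h', if_neg h, neg_zero]

/-- `F̃_νμ = −F̃_μν`. [cite: MagnenRivasseauSeneor1993, (II.1) p.328] -/
theorem curvCoeff_swap (lam : ℝ) (A : Config) (μ ν : Fin 4) (a : Fin 3) (k : Fin 4 → ℤ) :
    curvCoeff S lam A ν μ a k = -curvCoeff S lam A μ ν a k := by
  unfold curvCoeff
  rw [linCurv_swap, quadCurv_swap]
  simp only [Pi.neg_apply]
  ring

/-- Hence `|F̃_νμ|² = |F̃_μν|²`. [cite: MagnenRivasseauSeneor1993, (II.1) p.328] -/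
theorem normSq_curvCoeff_swap (lam : ℝ) (A : Config) (μ ν : Fin 4) (a : Fin 3) (k : Fin 4 → ℤ) :
    normSq (curvCoeff S lam A ν μ a k) = normSq (curvCoeff S lam A μ ν a k) := by
  rw [curvCoeff_swap, normSq_neg]

/-- The support of `F̃` on the window: `S₀ + S₀` with `S₀ = {0} ∪ S` (linear part on `S`, quadratic part on
`S + S`). [cite: MagnenRivasseauSeneor1993, (II.1)–(II.2) p.328] -/
def convSupport : Finset (Fin 4 → ℤ) :=
  Finset.image₂ (· + ·) (insert 0 (S.image Subtype.val)) (insert 0 (S.image Subtype.val))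

/-- Window momenta lie in the support. [cite: MagnenRivasseauSeneor1993, §II.A p.328] -/
theorem val_mem_convSupport {p : Momentum} (hp : p ∈ S) : p.1 ∈ convSupport S := by
  unfold convSupport
  rw [Finset.mem_image₂]
  exact ⟨p.1, Finset.mem_insert_of_mem (Finset.mem_image_of_mem _ hp), 0, Finset.mem_insert_self _ _,
    add_zero _⟩

/-- Sums of two window momenta lie in the support. [cite: MagnenRivasseauSeneor1993, §II.A p.328] -/
theorem add_mem_convSupport {q r : Momentum} (hq : q ∈ S) (hr : r ∈ S) : q.1 + r.1 ∈ convSupport S := by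
  unfold convSupport
  rw [Finset.mem_image₂]
  exact ⟨q.1, Finset.mem_insert_of_mem (Finset.mem_image_of_mem _ hq), r.1,
    Finset.mem_insert_of_mem (Finset.mem_image_of_mem _ hr), rfl⟩

/-- Outside the support the curvature coefficient vanishes: the finite sums over `convSupport S` below are the
COMPLETE Parseval sums `Σ_{k∈ℤ⁴}`. [cite: MagnenRivasseauSeneor1993, (II.2) p.328] -/
theorem curvCoeff_eq_zero_of_not_mem (lam : ℝ) (A : Config) (μ ν : Fin 4) (a : Fin 3) {k : Fin 4 → ℤ}
    (hk : k ∉ convSupport S) : curvCoeff S lam A μ ν a k = 0 := by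
  have hlin : ∀ ρ, coeffZ S A k ρ a = 0 := fun ρ =>
    coeffZ_eq_zero A (fun p hp h => hk (by rw [← h]; exact val_mem_convSupport S hp)) ρ a
  have hquad : quadCurv S A μ ν k = 0 := by
    unfold quadCurv
    refine Finset.sum_eq_zero fun q hq => Finset.sum_eq_zero fun r hr => ?_
    rw [if_neg]
    intro h
    exact hk (h ▸ add_mem_convSupport S hq hr)
  unfold curvCoeff linCurv
  rw [hlin, hlin, hquad]
  simp

/-! ## §3 (II.2) the action, (II.10) its spatial part, `⟨A, p₀²A⟩`, and the split (II.3) -/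

/-- **(II.2), the Yang–Mills ACTION** `(1/2)∫_Λ F² = −(1/2)∫_Λ d⁴x Tr F_μν F^μν = (1/4)∫_Λ d⁴x Σ_a F^a_μν F^{μν a}`
of the cut-off field on the window `S`, by Parseval at unit volume (READING (P)): `(1/4) Σ_k Σ_{μ,ν,a} |F̃^a_μν(k)|²`.
[cite: MagnenRivasseauSeneor1993, (II.2) p.328 tl.34–35 and p.328 tl.41–42] -/
def action (lam : ℝ) (A : Config) : ℝ :=
  (1 / 4) * ∑ k ∈ convSupport S, ∑ μ, ∑ ν, ∑ a, normSq (curvCoeff S lam A μ ν a k)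

/-- **(II.10), the SPATIAL PART** «F_sp ≡ −(1/2)∫_Λ d⁴x Tr F_mn F^mn = (1/4)∫_Λ d⁴x Σ_a F^a_mn F^{mn,a}» (spatial
indices `m, n = 1, 2, 3`, here `Fin.succ` of `Fin 3`), READING (P). [cite: MagnenRivasseauSeneor1993, (II.10) p.330 tl.7–9] -/
def Fsp (lam : ℝ) (A : Config) : ℝ :=
  (1 / 4) * ∑ k ∈ convSupport S, ∑ m : Fin 3, ∑ n : Fin 3, ∑ a,
    normSq (curvCoeff S lam A m.succ n.succ a k)

/-- **`⟨A, p₀²A⟩`** of (II.9)/(II.17)/(II.19)/(II.78): `(1/2) Σ_{p∈S} p₀² Σ_{μ,a} |Ã^a_μ(p)|²` (READING (P), factor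
`1/2` «in component notation», p.328 tl.40). [cite: MagnenRivasseauSeneor1993, (II.9) p.330 tl.6, p.328 tl.37–41] -/
def quadTime (A : Config) : ℝ :=
  (1 / 2) * ∑ p ∈ S, ((p.1 0 : ℤ) : ℝ) ^ 2 * ∑ μ, ∑ a, normSq (coeff A p μ a)

/-- (II.3), the QUADRATIC piece `F₂` of the action: `(1/4) Σ |(∂ ∧ A)~|²`.
[cite: MagnenRivasseauSeneor1993, (II.3) p.329 tl.2–3] -/
def F2 (A : Config) : ℝ :=
  (1 / 4) * ∑ k ∈ convSupport S, ∑ μ, ∑ ν, ∑ a, normSq (linCurv S A μ ν a k)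

/-- (II.3), the TRILINEAR piece `F₃`: `−(1/2) Σ Re((∂ ∧ A)~ · conj([A,A]~))`.
[cite: MagnenRivasseauSeneor1993, (II.3) p.329 tl.2–3] -/
def F3 (A : Config) : ℝ :=
  -(1 / 2) * ∑ k ∈ convSupport S, ∑ μ, ∑ ν, ∑ a, (linCurv S A μ ν a k * conj (quadCurv S A μ ν k a)).re

/-- (II.3), the QUARTIC piece `F₄`: `(1/4) Σ |[A,A]~|²`. [cite: MagnenRivasseauSeneor1993, (II.3) p.329 tl.2–3] -/
def F4 (A : Config) : ℝ :=
  (1 / 4) * ∑ k ∈ convSupport S, ∑ μ, ∑ ν, ∑ a, normSq (quadCurv S A μ ν k a)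

/-- Spatial quadratic piece `F_{2,sp}`. [cite: MagnenRivasseauSeneor1993, (II.3) p.329, (II.10) p.330] -/
def F2sp (A : Config) : ℝ :=
  (1 / 4) * ∑ k ∈ convSupport S, ∑ m : Fin 3, ∑ n : Fin 3, ∑ a, normSq (linCurv S A m.succ n.succ a k)

/-- Spatial trilinear piece `F_{3,sp}`. [cite: MagnenRivasseauSeneor1993, (II.3) p.329, (II.10) p.330] -/
def F3sp (A : Config) : ℝ :=
  -(1 / 2) * ∑ k ∈ convSupport S, ∑ m : Fin 3, ∑ n : Fin 3, ∑ a,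
    (linCurv S A m.succ n.succ a k * conj (quadCurv S A m.succ n.succ k a)).re

/-- Spatial quartic piece `F_{4,sp}`. [cite: MagnenRivasseauSeneor1993, (II.3) p.329, (II.10) p.330] -/
def F4sp (A : Config) : ℝ :=
  (1 / 4) * ∑ k ∈ convSupport S, ∑ m : Fin 3, ∑ n : Fin 3, ∑ a, normSq (quadCurv S A m.succ n.succ k a)

/-- Pointwise expansion in the coupling: `|L − λQ|² = |L|² + λ²|Q|² − 2λ Re(L conj Q)`.
[cite: MagnenRivasseauSeneor1993, (II.3) p.329 tl.2–3] -/
theorem normSq_curvCoeff (lam : ℝ) (A : Config) (μ ν : Fin 4) (a : Fin 3) (k : Fin 4 → ℤ) :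
    normSq (curvCoeff S lam A μ ν a k) =
      normSq (linCurv S A μ ν a k) + lam ^ 2 * normSq (quadCurv S A μ ν k a) -
        2 * lam * (linCurv S A μ ν a k * conj (quadCurv S A μ ν k a)).re := by
  unfold curvCoeff
  rw [normSq_sub, map_mul, normSq_ofReal, map_mul, conj_ofReal]
  have : linCurv S A μ ν a k * ((lam : ℂ) * conj (quadCurv S A μ ν k a)) =
      (lam : ℂ) * (linCurv S A μ ν a k * conj (quadCurv S A μ ν k a)) := by ring
  rw [this, re_ofReal_mul]
  ring

/-- **(II.3) PROVED**: «F² = F₂ + λF₃ + λ²F₄» for the action on every window.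
[cite: MagnenRivasseauSeneor1993, (II.3) p.329 tl.2–3] -/
theorem action_eq_F2_F3_F4 (lam : ℝ) (A : Config) :
    action S lam A = F2 S A + lam * F3 S A + lam ^ 2 * F4 S A := by
  unfold action F2 F3 F4
  simp only [normSq_curvCoeff, Finset.sum_add_distrib, Finset.sum_sub_distrib, ← Finset.mul_sum]
  ring

/-- (II.3) for the spatial part: `F_sp = F_{2,sp} + λF_{3,sp} + λ²F_{4,sp}`.
[cite: MagnenRivasseauSeneor1993, (II.3) p.329, (II.10) p.330] -/
theorem Fsp_eq (lam : ℝ) (A : Config) :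
    Fsp S lam A = F2sp S A + lam * F3sp S A + lam ^ 2 * F4sp S A := by
  unfold Fsp F2sp F3sp F4sp
  simp only [normSq_curvCoeff, Finset.sum_add_distrib, Finset.sum_sub_distrib, ← Finset.mul_sum]
  ring

/-- The action is nonnegative. [cite: MagnenRivasseauSeneor1993, (II.2) p.328] -/
theorem action_nonneg (lam : ℝ) (A : Config) : 0 ≤ action S lam A := by
  unfold action
  refine mul_nonneg (by norm_num) (Finset.sum_nonneg fun _ _ => Finset.sum_nonneg fun _ _ =>
    Finset.sum_nonneg fun _ _ => Finset.sum_nonneg fun _ _ => normSq_nonneg _)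

/-- **«both pieces in (II.9) are obviously positive»** — the spatial part: `0 ≤ F_sp`.
[cite: MagnenRivasseauSeneor1993, p.330 tl.10] -/
theorem Fsp_nonneg (lam : ℝ) (A : Config) : 0 ≤ Fsp S lam A := by
  unfold Fsp
  refine mul_nonneg (by norm_num) (Finset.sum_nonneg fun _ _ => Finset.sum_nonneg fun _ _ =>
    Finset.sum_nonneg fun _ _ => Finset.sum_nonneg fun _ _ => normSq_nonneg _)

/-- **«both pieces in (II.9) are obviously positive»** — the time piece: `0 ≤ ⟨A, p₀²A⟩`.
[cite: MagnenRivasseauSeneor1993, p.330 tl.10] -/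
theorem quadTime_nonneg (A : Config) : 0 ≤ quadTime S A := by
  unfold quadTime
  refine mul_nonneg (by norm_num) (Finset.sum_nonneg fun _ _ => mul_nonneg (sq_nonneg _)
    (Finset.sum_nonneg fun _ _ => Finset.sum_nonneg fun _ _ => normSq_nonneg _))

/-- `0 ≤ F₂`. [cite: MagnenRivasseauSeneor1993, (II.3) p.329] -/
theorem F2_nonneg (A : Config) : 0 ≤ F2 S A := by
  unfold F2
  refine mul_nonneg (by norm_num) (Finset.sum_nonneg fun _ _ => Finset.sum_nonneg fun _ _ =>
    Finset.sum_nonneg fun _ _ => Finset.sum_nonneg fun _ _ => normSq_nonneg _)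

/-- `0 ≤ F₄`. [cite: MagnenRivasseauSeneor1993, (II.3) p.329] -/
theorem F4_nonneg (A : Config) : 0 ≤ F4 S A := by
  unfold F4
  refine mul_nonneg (by norm_num) (Finset.sum_nonneg fun _ _ => Finset.sum_nonneg fun _ _ =>
    Finset.sum_nonneg fun _ _ => Finset.sum_nonneg fun _ _ => normSq_nonneg _)

/-- At `λ = 0` the action is its quadratic piece. [cite: MagnenRivasseauSeneor1993, (II.3) p.329] -/
theorem action_zero (A : Config) : action S 0 A = F2 S A := by
  rw [action_eq_F2_F3_F4]; ring

/-! ## §4 (II.9): in the axial gauge `(1/2)∫F² = ⟨A, p₀²A⟩ + F_sp` -/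

/-- `[0, Y] = 0`. [cite: MagnenRivasseauSeneor1993, §II.A p.328 tl.33] -/
theorem cross_zero_left (w : Fin 3 → ℂ) : (fun _ : Fin 3 => (0 : ℂ)) ⨯₃ w = 0 := by
  have : (fun _ : Fin 3 => (0 : ℂ)) = 0 := rfl
  rw [this, map_zero, LinearMap.zero_apply]

/-- `[X, 0] = 0`. [cite: MagnenRivasseauSeneor1993, §II.A p.328 tl.33] -/
theorem cross_zero_right (v : Fin 3 → ℂ) : v ⨯₃ (fun _ : Fin 3 => (0 : ℂ)) = 0 := by
  have : (fun _ : Fin 3 => (0 : ℂ)) = 0 := rfl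
  rw [this, map_zero]

/-- In the axial gauge `F̃_{00} = 0`. [cite: MagnenRivasseauSeneor1993, (II.7) p.329, (II.9) p.330] -/
theorem curvCoeff_time_time {A : Config} (hA : IsAxial A) (lam : ℝ) (a : Fin 3) (k : Fin 4 → ℤ) :
    curvCoeff S lam A 0 0 a k = 0 := by
  unfold curvCoeff linCurv quadCurv
  simp only [coeffZ_time hA, coeff_time hA, cross_zero_left, ite_self, Finset.sum_const_zero,
    Pi.zero_apply, sub_self, mul_zero]

/-- In the axial gauge `F̃^a_{0n}(k) = i k₀ Ã^a_n(k)` (no commutator term: `A₀ = 0`).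
[cite: MagnenRivasseauSeneor1993, (II.7) p.329, (II.9) p.330] -/
theorem curvCoeff_time_left {A : Config} (hA : IsAxial A) (lam : ℝ) (ν : Fin 4) (a : Fin 3)
    (k : Fin 4 → ℤ) : curvCoeff S lam A 0 ν a k = I * ((k 0 : ℤ) : ℂ) * coeffZ S A k ν a := by
  unfold curvCoeff linCurv quadCurv
  simp only [coeffZ_time hA, coeff_time hA, cross_zero_left, ite_self, Finset.sum_const_zero,
    Pi.zero_apply, mul_zero, sub_zero]
  ring

/-- A function of `coeffZ S A k` summed over the support equals the same summed over the window (it vanishes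
elsewhere). [cite: MagnenRivasseauSeneor1993, §II.A p.328] -/
theorem sum_convSupport_coeffZ (A : Config) (g : (Fin 4 → ℤ) → (Fin 4 → Fin 3 → ℂ) → ℝ)
    (hg : ∀ k, g k (fun _ _ => 0) = 0) :
    ∑ k ∈ convSupport S, g k (coeffZ S A k) = ∑ p ∈ S, g p.1 (coeff A p) := by
  classical
  have hsub : S.image Subtype.val ⊆ convSupport S := by
    intro k hk
    obtain ⟨p, hp, rfl⟩ := Finset.mem_image.mp hk
    exact val_mem_convSupport S hp
  rw [← Finset.sum_subset hsub]
  · rw [Finset.sum_image fun p _ q _ h => Subtype.ext h]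
    refine Finset.sum_congr rfl fun p hp => ?_
    congr 1
    funext μ a
    exact coeffZ_val A hp μ a
  · intro k _ hk
    have : coeffZ S A k = fun _ _ => 0 := by
      funext μ a
      exact coeffZ_eq_zero A (fun p hp h => hk (Finset.mem_image.mpr ⟨p, hp, h⟩)) μ a
    rw [this, hg]

/-- A double sum over `Fin 4 × Fin 4` split into time/space blocks.
[cite: MagnenRivasseauSeneor1993, §II.A p.328 tl.18–20 («the index μ = 0, called the time, and the three other indices»)] -/
theorem sum_fin4_fin4_split (f : Fin 4 → Fin 4 → ℝ) :
    ∑ μ, ∑ ν, f μ ν = f 0 0 + ∑ n : Fin 3, f 0 n.succ + ∑ m : Fin 3, f m.succ 0 +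
      ∑ m : Fin 3, ∑ n : Fin 3, f m.succ n.succ := by
  rw [Fin.sum_univ_succ]
  have h1 : ∑ ν, f 0 ν = f 0 0 + ∑ n : Fin 3, f 0 n.succ := Fin.sum_univ_succ _
  have h2 : ∀ m : Fin 3, ∑ ν, f m.succ ν = f m.succ 0 + ∑ n : Fin 3, f m.succ n.succ :=
    fun m => Fin.sum_univ_succ _
  rw [h1, Finset.sum_congr rfl fun m _ => h2 m, Finset.sum_add_distrib]
  ring

/-- A sum over `Fin 4` split into the time term and the spatial terms.
[cite: MagnenRivasseauSeneor1993, §II.A p.328 tl.18–20] -/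
theorem sum_fin4_split (f : Fin 4 → ℝ) : ∑ μ, f μ = f 0 + ∑ n : Fin 3, f n.succ := Fin.sum_univ_succ _

/-- **(II.9) PROVED** — «Indeed in the axial gauge we have F² = ⟨Ap₀²A⟩ + F²_sp»: for every axial configuration,
every window and every coupling, the action (II.2) is `⟨A, p₀²A⟩` plus the spatial part (II.10) (READINGS (P), (Q)).
[cite: MagnenRivasseauSeneor1993, (II.9) p.330 tl.6] -/
theorem action_eq_quadTime_add_Fsp {A : Config} (hA : IsAxial A) (lam : ℝ) :
    action S lam A = quadTime S A + Fsp S lam A := by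
  classical
  -- the mixed blocks: `Σ_k Σ_n Σ_a |F̃_{0n}|² = Σ_{p∈S} p₀² Σ_n Σ_a |Ã_n(p)|²`
  have hmixed : ∑ k ∈ convSupport S, ∑ n : Fin 3, ∑ a, normSq (curvCoeff S lam A 0 n.succ a k) =
      ∑ p ∈ S, ((p.1 0 : ℤ) : ℝ) ^ 2 * ∑ n : Fin 3, ∑ a, normSq (coeff A p n.succ a) := by
    have e := sum_convSupport_coeffZ S A
      (fun k c => ∑ n : Fin 3, ∑ a, normSq (I * ((k 0 : ℤ) : ℂ) * c n.succ a))
      (fun k => by simp)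
    simp only [curvCoeff_time_left S hA] at e ⊢
    rw [e]
    refine Finset.sum_congr rfl fun p _ => ?_
    rw [Finset.mul_sum]
    refine Finset.sum_congr rfl fun n _ => ?_
    rw [Finset.mul_sum]
    refine Finset.sum_congr rfl fun a _ => ?_
    rw [map_mul, map_mul, normSq_I, one_mul, ← ofReal_intCast, normSq_ofReal]
    ring
  -- the time coefficients do not contribute to `⟨A, p₀²A⟩`
  have htime : quadTime S A =
      (1 / 2) * ∑ p ∈ S, ((p.1 0 : ℤ) : ℝ) ^ 2 * ∑ n : Fin 3, ∑ a, normSq (coeff A p n.succ a) := by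
    unfold quadTime
    congr 1
    refine Finset.sum_congr rfl fun p _ => ?_
    congr 1
    rw [sum_fin4_split]
    simp [coeff_time hA]
  unfold action Fsp
  rw [htime]
  have hsplit : ∀ k ∈ convSupport S, ∑ μ, ∑ ν, ∑ a, normSq (curvCoeff S lam A μ ν a k) =
      2 * (∑ n : Fin 3, ∑ a, normSq (curvCoeff S lam A 0 n.succ a k)) +
        ∑ m : Fin 3, ∑ n : Fin 3, ∑ a, normSq (curvCoeff S lam A m.succ n.succ a k) := by
    intro k _
    rw [sum_fin4_fin4_split (fun μ ν => ∑ a, normSq (curvCoeff S lam A μ ν a k))]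
    simp only [curvCoeff_time_time S hA, map_zero, Finset.sum_const_zero, zero_add,
      normSq_curvCoeff_swap S lam A 0]
    ring
  rw [Finset.sum_congr rfl hsplit, Finset.sum_add_distrib, ← Finset.mul_sum, hmixed]
  ring

/-- (II.9) at `λ = 0`: the free axial action is `⟨A, p₀²A⟩ + F_{2,sp}`.
[cite: MagnenRivasseauSeneor1993, (II.9) p.330, (II.3) p.329] -/
theorem F2_eq_quadTime_add_F2sp {A : Config} (hA : IsAxial A) : F2 S A = quadTime S A + F2sp S A := by
  have h := action_eq_quadTime_add_Fsp S hA 0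
  rw [action_zero, Fsp_eq] at h
  simpa using h

/-! ## §5 The quadratic forms `⟨A, w(p)A⟩`; (II.16) and (II.19) from the NAMED parameters -/

/-- `⟨A, w(p)A⟩` on the window: `(1/2) Σ_{p∈S} w(p) Σ_{μ,a} |Ã^a_μ(p)|²` (READING (P)).
[cite: MagnenRivasseauSeneor1993, p.328 tl.37–41, (II.16) p.332] -/
def quadForm (w : Momentum → ℝ) (A : Config) : ℝ :=
  (1 / 2) * ∑ p ∈ S, w p * ∑ μ, ∑ a, normSq (coeff A p μ a)

/-- `⟨A, p₀²A⟩` is the quadratic form of the symbol `p₀²`. [cite: MagnenRivasseauSeneor1993, (II.9) p.330, (II.19) p.332] -/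
theorem quadTime_eq_quadForm (A : Config) :
    quadTime S A = quadForm S (fun p => ((p.1 0 : ℤ) : ℝ) ^ 2) A := rfl

/-- A nonnegative symbol gives a nonnegative form. [cite: MagnenRivasseauSeneor1993, p.328 tl.40 («positive definite»)] -/
theorem quadForm_nonneg {w : Momentum → ℝ} (hw : ∀ p ∈ S, 0 ≤ w p) (A : Config) : 0 ≤ quadForm S w A := by
  unfold quadForm
  refine mul_nonneg (by norm_num) (Finset.sum_nonneg fun p hp => mul_nonneg (hw p hp)
    (Finset.sum_nonneg fun _ _ => Finset.sum_nonneg fun _ _ => normSq_nonneg _))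

/-- The form is linear in the symbol: sums. [cite: MagnenRivasseauSeneor1993, (II.16) p.332] -/
theorem quadForm_add (w w' : Momentum → ℝ) (A : Config) :
    quadForm S (fun p => w p + w' p) A = quadForm S w A + quadForm S w' A := by
  unfold quadForm
  rw [← mul_add, ← Finset.sum_add_distrib]
  congr 1
  exact Finset.sum_congr rfl fun p _ => by ring

/-- The form is linear in the symbol: scalars. [cite: MagnenRivasseauSeneor1993, (II.16) p.332] -/
theorem quadForm_const_mul (c : ℝ) (w : Momentum → ℝ) (A : Config) :
    quadForm S (fun p => c * w p) A = c * quadForm S w A := by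
  unfold quadForm
  rw [Finset.mul_sum, Finset.mul_sum, Finset.mul_sum]
  exact Finset.sum_congr rfl fun p _ => by ring

/-- The form is linear in the symbol: finite sums. [cite: MagnenRivasseauSeneor1993, (II.16) p.332] -/
theorem quadForm_sum {ι : Type*} (T : Finset ι) (w : ι → Momentum → ℝ) (A : Config) :
    quadForm S (fun p => ∑ i ∈ T, w i p) A = ∑ i ∈ T, quadForm S (w i) A := by
  classical
  induction T using Finset.induction_on with
  | empty => simp [quadForm]
  | insert i T hi ih =>
    rw [Finset.sum_insert hi, ← ih, ← quadForm_add]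
    exact congrArg (fun w => quadForm S w A) (funext fun p => Finset.sum_insert hi)

variable (par : Parameters)

/-- **`Σ_{i≤ρ₁} (λ_i^t)² ⟨A, p²κ^i(p)A⟩`** of (II.16)–(II.18)/(II.78) from the NAMED parameters («the sum over i in
(II.18) stops at ρ₁», p.332 tl.20–21; `(λ_i^t)² = par.tentativeCoupling i` (II.12); `κ^i = sliceCutoff` (II.15);
«p²» = `|p|²`). [cite: MagnenRivasseauSeneor1993, (II.16) p.332 tl.3–4, (II.18) p.332 tl.16–21, p.331 tl.18–20] -/
def quadSlices (ρ₁ : ℕ) (A : Config) : ℝ :=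
  ∑ i ∈ Finset.range (ρ₁ + 1), par.tentativeCoupling i *
    quadForm S (fun p => p.norm ^ 2 * sliceCutoff par.τ par.η par.M i p.norm) A

/-- **(II.16) PROVED**: «Σ_i (λ_i^t)²⟨A, p²κ^i(p)A⟩ = ⟨A, C₀⁻¹A⟩» with the tree's symbol `C₀⁻¹(p) =
Parameters.invC0 ρ₁ |p| = |p|² Σ_{i≤ρ₁} (λ_i^t)² κ^i(|p|)`. [cite: MagnenRivasseauSeneor1993, (II.16) p.332 tl.3–4] -/
theorem quadSlices_eq_invC0 (ρ₁ : ℕ) (A : Config) :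
    quadSlices S par ρ₁ A = quadForm S (fun p => par.invC0 ρ₁ p.norm) A := by
  unfold quadSlices Parameters.invC0
  simp_rw [Finset.mul_sum]
  rw [quadForm_sum]
  refine Finset.sum_congr rfl fun i _ => ?_
  rw [← quadForm_const_mul]
  exact congrArg (fun w => quadForm S w A) (funext fun p => by ring)

/-- **(II.19) PROVED**: «⟨A, p₀²A⟩ + Σ_i(λ_i^t)²⟨Ap²κ^i(p)A⟩ = ⟨A, C_axial⁻¹A⟩» with `C_axial⁻¹(p) = p₀² + C₀⁻¹(p)`.
[cite: MagnenRivasseauSeneor1993, (II.19) p.332 tl.22–23] -/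
theorem quadTime_add_quadSlices (ρ₁ : ℕ) (A : Config) :
    quadTime S A + quadSlices S par ρ₁ A =
      quadForm S (fun p => ((p.1 0 : ℤ) : ℝ) ^ 2 + par.invC0 ρ₁ p.norm) A := by
  rw [quadTime_eq_quadForm, quadSlices_eq_invC0, ← quadForm_add]

/-- … and that symbol IS the tree's `Ansatz.invCaxial` of `…StartingAnsatz` §6 (for nonnegative squared couplings,
`λ_i^t = √((λ_i^t)²)`, cf. `Parameters.invC0_eq_ansatz`). [cite: MagnenRivasseauSeneor1993, (II.19) p.332 tl.22–23] -/
theorem quadTime_add_quadSlices_eq_invCaxial (ρ₁ : ℕ) (A : Config)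
    (hlam : ∀ i, 0 ≤ par.tentativeCoupling i) :
    quadTime S A + quadSlices S par ρ₁ A =
      quadForm S (fun p => Ansatz.invCaxial par.τ par.η par.M
        (fun i => Real.sqrt (par.tentativeCoupling i)) ρ₁ ((p.1 0 : ℤ) : ℝ) (p.norm ^ 2)) A := by
  rw [quadTime_add_quadSlices]
  refine congrArg (fun w => quadForm S w A) (funext fun p => ?_)
  unfold Ansatz.invCaxial
  rw [par.invC0_eq_ansatz ρ₁ p.norm_nonneg hlam]

/-- `0 ≤ Σ_i (λ_i^t)²⟨A, p²κ^iA⟩` when the squared couplings are nonnegative («C is a large constant», p.330 tl.21).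
[cite: MagnenRivasseauSeneor1993, (II.16) p.332, p.330 tl.21] -/
theorem quadSlices_nonneg (ρ₁ : ℕ) (A : Config) (hlam : ∀ i, 0 ≤ par.tentativeCoupling i) :
    0 ≤ quadSlices S par ρ₁ A := by
  unfold quadSlices
  refine Finset.sum_nonneg fun i _ => mul_nonneg (hlam i) (quadForm_nonneg S (fun p _ => ?_) A)
  have hM : (1 : ℝ) ≤ par.M := par.one_lt_M.le
  exact mul_nonneg (sq_nonneg _) (sliceCutoff_nonneg par.τ par.η (par.M : ℝ) par.hη hM i p.norm_nonneg)

/-- `C₀⁻¹(p) ≥ 0` for nonnegative squared couplings (the slices `κ^i` are nonnegative).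
[cite: MagnenRivasseauSeneor1993, (II.16) p.332, (II.15) p.331] -/
theorem Parameters.invC0_nonneg' (ρ₁ : ℕ) (hlam : ∀ i, 0 ≤ par.tentativeCoupling i) {r : ℝ} (hr : 0 ≤ r) :
    0 ≤ par.invC0 ρ₁ r := by
  unfold Parameters.invC0
  have hM : (1 : ℝ) ≤ par.M := par.one_lt_M.le
  exact mul_nonneg (sq_nonneg _) (Finset.sum_nonneg fun i _ =>
    mul_nonneg (hlam i) (sliceCutoff_nonneg par.τ par.η (par.M : ℝ) par.hη hM i hr))

/-! ## §6 The exponent of (II.17)/(II.18) and the third factor of (II.78) -/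

/-- **THE EXPONENT of (II.17)/(II.18)/(II.78)**: `(1/2)(−F_sp(A) − ⟨A,p₀²A⟩ + Σ_{i≤ρ₁}(λ_i^t)²⟨A,(p²κ^i(p))A⟩)` on
the window `S`, coupling `lam` inside `F_sp` (READING (R)). [cite: MagnenRivasseauSeneor1993, (II.17) p.332 tl.6–7, (II.18) p.332 tl.16–18, (II.78) p.347 tl.2–7] -/
def bareExponent (lam : ℝ) (ρ₁ : ℕ) (A : Config) : ℝ :=
  (1 / 2) * (-Fsp S lam A - quadTime S A + quadSlices S par ρ₁ A)

/-- **THE THIRD FACTOR of (II.78)** (= the density of (II.17)/(II.18)): `e^{(1/2)(−F²_sp(A) − ⟨A,p₀²A⟩ +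
Σ_i λ²⟨A,(p²κ^i(p))A⟩)}` as a function on configurations. [cite: MagnenRivasseauSeneor1993, (II.78) p.347 tl.2–7, (II.18) p.332] -/
def ymFactor (lam : ℝ) (ρ₁ : ℕ) (A : Config) : ℝ := Real.exp (bareExponent S par lam ρ₁ A)

/-- The factor is positive. [cite: MagnenRivasseauSeneor1993, (II.18) p.332] -/
theorem ymFactor_pos (lam : ℝ) (ρ₁ : ℕ) (A : Config) : 0 < ymFactor S par lam ρ₁ A := Real.exp_pos _

/-- The exponent is at most its «positive exponential» part: `−F_sp − ⟨A,p₀²A⟩ ≤ 0`.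
[cite: MagnenRivasseauSeneor1993, p.330 tl.10, p.332 tl.24–25] -/
theorem bareExponent_le (lam : ℝ) (ρ₁ : ℕ) (A : Config) :
    bareExponent S par lam ρ₁ A ≤ (1 / 2) * quadSlices S par ρ₁ A := by
  unfold bareExponent
  have h1 := Fsp_nonneg S lam A
  have h2 := quadTime_nonneg S A
  nlinarith

/-- Hence the factor is dominated by the positive exponential `e^{(1/2)Σ_i(λ_i^t)²⟨A,p²κ^iA⟩}` of p.332 tl.24.
[cite: MagnenRivasseauSeneor1993, p.332 tl.24–25] -/
theorem ymFactor_le_exp_half_quadSlices (lam : ℝ) (ρ₁ : ℕ) (A : Config) :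
    ymFactor S par lam ρ₁ A ≤ Real.exp ((1 / 2) * quadSlices S par ρ₁ A) :=
  Real.exp_le_exp.mpr (bareExponent_le S par lam ρ₁ A)

/-- Each coefficient is a continuous function of the configuration (product topology).
[cite: MagnenRivasseauSeneor1993, §II.A p.328] -/
theorem continuous_coeff (p : Momentum) (μ : Fin 4) (a : Fin 3) : Continuous fun A : Config => coeff A p μ a := by
  unfold coeff
  fun_prop

/-- … so is its extension by zero. [cite: MagnenRivasseauSeneor1993, §II.A p.328] -/
theorem continuous_coeffZ (k : Fin 4 → ℤ) (μ : Fin 4) (a : Fin 3) :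
    Continuous fun A : Config => coeffZ S A k μ a := by
  unfold coeffZ
  split_ifs
  · exact continuous_const
  · exact continuous_coeff _ μ a
  · exact continuous_const

/-- The wedge product is continuous in its two arguments. [cite: MagnenRivasseauSeneor1993, §II.A p.328 tl.33] -/
theorem continuous_cross {X : Type*} [TopologicalSpace X] {f g : X → Fin 3 → ℂ} (hf : Continuous f)
    (hg : Continuous g) : Continuous fun x => f x ⨯₃ g x := by
  refine continuous_pi fun a => ?_
  have hf' : ∀ i, Continuous fun x => f x i := fun i => (continuous_apply i).comp hf
  have hg' : ∀ i, Continuous fun x => g x i := fun i => (continuous_apply i).comp hg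
  fin_cases a <;> simp [cross_apply] <;> fun_prop

/-- The quadratic part is continuous. [cite: MagnenRivasseauSeneor1993, (II.1) p.328] -/
theorem continuous_quadCurv (μ ν : Fin 4) (k : Fin 4 → ℤ) :
    Continuous fun A : Config => quadCurv S A μ ν k := by
  unfold quadCurv
  refine continuous_finsetSum _ fun q _ => continuous_finsetSum _ fun r _ => ?_
  split_ifs
  · exact continuous_cross (continuous_pi fun b => continuous_coeff q μ b)
      (continuous_pi fun c => continuous_coeff r ν c)
  · exact continuous_const

/-- The curvature coefficient is continuous. [cite: MagnenRivasseauSeneor1993, (II.1) p.328] -/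
theorem continuous_curvCoeff (lam : ℝ) (μ ν : Fin 4) (a : Fin 3) (k : Fin 4 → ℤ) :
    Continuous fun A : Config => curvCoeff S lam A μ ν a k := by
  unfold curvCoeff linCurv
  have h1 := continuous_coeffZ S k ν a
  have h2 := continuous_coeffZ S k μ a
  have h3 : Continuous fun A : Config => quadCurv S A μ ν k a :=
    (continuous_apply a).comp (continuous_quadCurv S μ ν k)
  fun_prop

/-- `F_sp` is continuous. [cite: MagnenRivasseauSeneor1993, (II.10) p.330] -/
theorem continuous_Fsp (lam : ℝ) : Continuous fun A : Config => Fsp S lam A := by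
  unfold Fsp
  refine continuous_const.mul (continuous_finsetSum _ fun k _ => continuous_finsetSum _ fun m _ =>
    continuous_finsetSum _ fun n _ => continuous_finsetSum _ fun a _ => ?_)
  exact continuous_normSq.comp (continuous_curvCoeff S lam _ _ a k)

/-- `⟨A, w(p)A⟩` is continuous. [cite: MagnenRivasseauSeneor1993, (II.16) p.332] -/
theorem continuous_quadForm (w : Momentum → ℝ) : Continuous fun A : Config => quadForm S w A := by
  unfold quadForm
  refine continuous_const.mul (continuous_finsetSum _ fun p _ => continuous_const.mul
    (continuous_finsetSum _ fun μ _ => continuous_finsetSum _ fun a _ => ?_))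
  exact continuous_normSq.comp (continuous_coeff p μ a)

/-- `Σ_i (λ_i^t)²⟨A, p²κ^iA⟩` is continuous. [cite: MagnenRivasseauSeneor1993, (II.16) p.332] -/
theorem continuous_quadSlices (ρ₁ : ℕ) : Continuous fun A : Config => quadSlices S par ρ₁ A := by
  unfold quadSlices
  exact continuous_finsetSum _ fun i _ => continuous_const.mul (continuous_quadForm S _)

/-- The exponent is continuous. [cite: MagnenRivasseauSeneor1993, (II.18) p.332] -/
theorem continuous_bareExponent (lam : ℝ) (ρ₁ : ℕ) :
    Continuous fun A : Config => bareExponent S par lam ρ₁ A := by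
  unfold bareExponent
  have h1 := continuous_Fsp S lam
  have h2 : Continuous fun A : Config => quadTime S A := by
    simp_rw [quadTime_eq_quadForm]; exact continuous_quadForm S _
  have h3 := continuous_quadSlices S par ρ₁
  fun_prop

/-- **The third factor of (II.78) is a continuous, hence measurable, function on configurations** — a genuine
density against the reference measure `dμ_{0,ρ₁}` of `…GaussianReferenceMeasures` (whether the product is
normalisable is another matter: §7). [cite: MagnenRivasseauSeneor1993, (II.78) p.347, (II.18) p.332] -/
theorem continuous_ymFactor (lam : ℝ) (ρ₁ : ℕ) : Continuous fun A : Config => ymFactor S par lam ρ₁ A :=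
  Real.continuous_exp.comp (continuous_bareExponent S par lam ρ₁)

/-- Measurability of the factor. [cite: MagnenRivasseauSeneor1993, (II.78) p.347, (II.18) p.332] -/
theorem measurable_ymFactor (lam : ℝ) (ρ₁ : ℕ) : Measurable fun A : Config => ymFactor S par lam ρ₁ A :=
  (continuous_ymFactor S par lam ρ₁).measurable

/-! ## §7 «This formula is still formal, because the positive exponential cannot be integrated simply with the
Gaussian measure dμ_{0,ρ₁} (this would give back the ill-defined Lebesgue measure)» (p.332 tl.24–26) — KERNEL-CHECKED -/

/-- One real mode: against `𝒩(0, v)` the positive exponential `e^{c x²/2}` with `c = v⁻¹` integrates to `+∞`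
(density × exponential = the constant `(2πv)^{−1/2}`: Lebesgue measure). [cite: MagnenRivasseauSeneor1993, p.332 tl.24–26] -/
theorem lintegral_exp_half_mul_sq_gaussianReal_eq_top {c : ℝ} (hc : 0 < c) {v : ℝ≥0} (hv : (v : ℝ) = c⁻¹) :
    ∫⁻ x, ENNReal.ofReal (Real.exp (c / 2 * x ^ 2)) ∂(gaussianReal 0 v) = ⊤ := by
  have hv0 : v ≠ 0 := by
    intro h
    rw [h, NNReal.coe_zero] at hv
    exact (inv_pos.mpr hc).ne' hv.symm
  have hvpos : (0 : ℝ) < v := by rw [hv]; exact inv_pos.mpr hc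
  rw [gaussianReal_of_var_ne_zero 0 hv0,
    lintegral_withDensity_eq_lintegral_mul _ (measurable_gaussianPDF 0 v) (by fun_prop)]
  have hconst : (fun x : ℝ => (gaussianPDF 0 v * fun x => ENNReal.ofReal (Real.exp (c / 2 * x ^ 2))) x) =
      fun _ => ENNReal.ofReal ((Real.sqrt (2 * Real.pi * v))⁻¹) := by
    funext x
    simp only [Pi.mul_apply, gaussianPDF, gaussianPDFReal]
    rw [← ENNReal.ofReal_mul (mul_nonneg (inv_nonneg.mpr (Real.sqrt_nonneg _)) (Real.exp_nonneg _)),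
      mul_assoc, ← Real.exp_add]
    congr 1
    have : -(x - 0) ^ 2 / (2 * (v : ℝ)) + c / 2 * x ^ 2 = 0 := by
      rw [hv]; field_simp; ring
    rw [this, Real.exp_zero, mul_one]
  rw [hconst, lintegral_const, Real.volume_univ, ENNReal.mul_top]
  rw [Ne, ENNReal.ofReal_eq_zero, not_le]
  exact inv_pos.mpr (Real.sqrt_pos.mpr (by positivity))

/-- The same for one coordinate of the independent Gaussian modes `⊗_m 𝒩(0, v m)`.
[cite: MagnenRivasseauSeneor1993, p.332 tl.24–26, (II.18) p.332] -/
theorem lintegral_exp_half_mul_sq_modeGaussian_eq_top {L : Type*} (v : Momentum × L → ℝ≥0)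
    (m : Momentum × L) {c : ℝ} (hc : 0 < c) (hv : (v m : ℝ) = c⁻¹) :
    ∫⁻ X, ENNReal.ofReal (Real.exp (c / 2 * X m ^ 2)) ∂(modeGaussian v) = ⊤ := by
  have e := lintegral_map (μ := modeGaussian v) (f := fun x : ℝ => ENNReal.ofReal (Real.exp (c / 2 * x ^ 2)))
    (by fun_prop) (measurable_pi_apply m)
  rw [modeGaussian, Measure.infinitePi_map_eval] at e
  rw [modeGaussian, ← e]
  exact lintegral_exp_half_mul_sq_gaussianReal_eq_top hc hv

/-- The representative of `(−p, ℓ)` is the representative of `(p, ℓ)` (both are the positive one of `±p`).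
[cite: MagnenRivasseauSeneor1993, §II.A p.328 tl.12–17] -/
theorem rep_neg {L : Type*} (p : Momentum) (ℓ : L) : rep (p.neg, ℓ) = rep (p, ℓ) := by
  unfold rep
  rcases Momentum.isPos_or_isPos_neg p with h | h
  · rw [if_neg (Momentum.not_isPos_neg_of_isPos h), if_pos h, Momentum.neg_neg]
  · have h' : ¬ p.IsPos := fun hp => Momentum.not_isPos_neg_of_isPos hp h
    rw [if_pos h, if_neg h']

/-- A realified coordinate squared is the representative coordinate squared (`sgn² = 1`).
[cite: MagnenRivasseauSeneor1993, §II.A p.328 tl.12–17] -/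
theorem realify_sq {L : Type*} (im : L → Bool) (X : Momentum × L → ℝ) (m : Momentum × L) :
    realify im X m ^ 2 = X (rep m) ^ 2 := by
  unfold realify
  rw [mul_pow, sgn_sq, one_mul]

/-- `p ≠ −p` on `ℤ⁴ ∖ {0}`. [cite: MagnenRivasseauSeneor1993, §II.A p.328 tl.13–15] -/
theorem Momentum.neg_ne_self (p : Momentum) : p.neg ≠ p := by
  intro h
  apply p.2
  funext μ
  have := congrArg (fun q : Momentum => q.1 μ) h
  simp only [Momentum.neg_apply] at this
  have : (p.1 μ) = 0 := by omega
  simpa using this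

/-- LOWER BOUND: on a window containing `±p₀`, `(1/2)⟨A, C₀⁻¹A⟩ ≥ (1/2) C₀⁻¹(p₀) (Re Ã^{a₀}_{μ₀}(p₀))²` for a
realified configuration — the two terms at `p₀` and `−p₀` of the Parseval sum are equal (reality).
[cite: MagnenRivasseauSeneor1993, (II.16) p.332, §II.A p.328 tl.12–17] -/
theorem half_invC0_sq_le_half_quadSlices (ρ₁ : ℕ) {p₀ : Momentum} (hp : p₀ ∈ S) (hpn : p₀.neg ∈ S)
    (hC : ∀ p ∈ S, 0 ≤ par.invC0 ρ₁ p.norm) (μ₀ : Fin 4) (a₀ : Fin 3)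
    (X : Momentum × (Fin 4 × Fin 3 × Bool) → ℝ) :
    par.invC0 ρ₁ p₀.norm / 2 * X (rep (p₀, μ₀, a₀, false)) ^ 2 ≤
      (1 / 2) * quadSlices S par ρ₁ (realify modeIm X) := by
  classical
  rw [quadSlices_eq_invC0]
  unfold quadForm
  set A := realify modeIm X with hA
  set g : Momentum → ℝ := fun p => par.invC0 ρ₁ p.norm * ∑ μ, ∑ a, normSq (coeff A p μ a) with hg
  have hg0 : ∀ p ∈ S, 0 ≤ g p := fun p hp =>
    mul_nonneg (hC p hp) (Finset.sum_nonneg fun _ _ => Finset.sum_nonneg fun _ _ => normSq_nonneg _)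
  -- the two terms at `p₀` and `−p₀`
  have hpair : g p₀ + g p₀.neg ≤ ∑ p ∈ S, g p := by
    have hsub : ({p₀, p₀.neg} : Finset Momentum) ⊆ S := by
      intro p hp'
      rcases Finset.mem_insert.mp hp' with rfl | hp'
      · exact hp
      · rw [Finset.mem_singleton] at hp'; rw [hp']; exact hpn
    have := Finset.sum_le_sum_of_subset_of_nonneg hsub fun p hp _ => hg0 p hp
    rwa [Finset.sum_pair p₀.neg_ne_self.symm] at this
  -- each of them dominates the chosen real coordinate squared
  have hterm : ∀ p : Momentum, rep (p, μ₀, a₀, false) = rep (p₀, μ₀, a₀, false) → p.norm = p₀.norm →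
      par.invC0 ρ₁ p₀.norm * X (rep (p₀, μ₀, a₀, false)) ^ 2 ≤ g p := by
    intro p hrep hnorm
    rw [hg]
    simp only
    rw [hnorm]
    refine mul_le_mul_of_nonneg_left ?_ (hC p₀ hp)
    calc X (rep (p₀, μ₀, a₀, false)) ^ 2 = A (p, μ₀, a₀, false) ^ 2 := by
            rw [hA, realify_sq, hrep]
      _ ≤ normSq (coeff A p μ₀ a₀) := by rw [normSq_coeff]; nlinarith [sq_nonneg (A (p, μ₀, a₀, true))]
      _ ≤ ∑ a, normSq (coeff A p μ₀ a) :=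
            Finset.single_le_sum (f := fun a => normSq (coeff A p μ₀ a)) (fun _ _ => normSq_nonneg _)
              (Finset.mem_univ a₀)
      _ ≤ ∑ μ, ∑ a, normSq (coeff A p μ a) :=
            Finset.single_le_sum (f := fun μ => ∑ a, normSq (coeff A p μ a))
              (fun _ _ => Finset.sum_nonneg fun _ _ => normSq_nonneg _) (Finset.mem_univ μ₀)
  have h1 := hterm p₀ rfl rfl
  have h2 := hterm p₀.neg (rep_neg p₀ _) p₀.norm_neg
  linarith

/-- **p.332 tl.24–26 KERNEL-CHECKED (literal instance).** On any window `S` containing a pair `±p₀` on the plateau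
of the fake cutoff (`κ_{ρ₁}(|p₀|) = 1`) where the printed propagator is defined (`C₀(p₀)⁻¹ > 0`; squared
couplings (II.12) nonnegative, «C is a large constant»), the positive exponential of (II.18) is NOT integrable against `dμ_{0,ρ₁}`:
`∫ e^{(1/2)Σ_{i≤ρ₁}(λ_i^t)²⟨A,p²κ^i(p)A⟩} dμ_{0,ρ₁}(A) = +∞` — on the real coordinate `Re Ã^{a₀}_{μ₀}(p₀)` the Gaussian
density `e^{−x²/(2C₀)}` and the factor `e^{+x²/(2C₀)}` cancel exactly («this would give back the ill-defined Lebesgue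
measure»). [cite: MagnenRivasseauSeneor1993, p.332 tl.24–26, (II.18) p.332 tl.16–21] -/
theorem lintegral_exp_half_quadSlices_muZero_eq_top (ρ₁ : ℕ) {p₀ : Momentum} (hp : p₀ ∈ S)
    (hpn : p₀.neg ∈ S) (hκ : par.uvCutoff ρ₁ p₀.norm = 1) (hC₀ : 0 < par.invC0 ρ₁ p₀.norm)
    (hlam : ∀ i, 0 ≤ par.tentativeCoupling i) {μ₀ : Fin 4} (hμ₀ : μ₀ ≠ 0) (a₀ : Fin 3) :
    ∫⁻ A, ENNReal.ofReal (Real.exp ((1 / 2) * quadSlices S par ρ₁ A)) ∂(muZero par ρ₁) = ⊤ := by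
  have hC : ∀ p ∈ S, 0 ≤ par.invC0 ρ₁ p.norm := fun p _ => par.invC0_nonneg' ρ₁ hlam p.norm_nonneg
  set m₀ : Mode := (p₀, μ₀, a₀, false) with hm₀
  set c := par.invC0 ρ₁ p₀.norm with hc
  have hmeas : Measurable fun A : Config => ENNReal.ofReal (Real.exp ((1 / 2) * quadSlices S par ρ₁ A)) :=
    ENNReal.measurable_ofReal.comp (Real.measurable_exp.comp
      ((continuous_quadSlices S par ρ₁).measurable.const_mul _))
  unfold muZero gaussianFieldLaw
  rw [lintegral_map hmeas (measurable_realify modeIm)]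
  -- the variance of the representative coordinate is `C₀(p₀) = c⁻¹` (`muZeroVariance_rep`: even under `p ↦ −p`)
  have hvar : ((par.muZeroVariance ρ₁ (rep m₀) : ℝ≥0) : ℝ) = c⁻¹ := by
    rw [muZeroVariance_rep]
    have hnt : ¬ Mode.IsTime m₀ := by rw [hm₀]; unfold Mode.IsTime; exact hμ₀
    unfold Parameters.muZeroVariance
    rw [if_neg hnt]
    show ((par.muZeroCovariance ρ₁ p₀.norm).toNNReal : ℝ) = c⁻¹
    unfold Parameters.muZeroCovariance
    rw [hκ, one_mul, Real.coe_toNNReal _ (inv_nonneg.mpr hC₀.le)]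
  have htop := lintegral_exp_half_mul_sq_modeGaussian_eq_top (par.muZeroVariance ρ₁) (rep m₀) hC₀ hvar
  refine eq_top_iff.mpr (le_trans (le_of_eq htop.symm) (lintegral_mono fun X => ?_))
  refine ENNReal.ofReal_le_ofReal (Real.exp_le_exp.mpr ?_)
  have := half_invC0_sq_le_half_quadSlices S par ρ₁ hp hpn hC μ₀ a₀ X
  rw [← hc] at this
  linarith

/-- Equivalently: the positive exponential of (II.18) is not an integrable function for `dμ_{0,ρ₁}` (so (II.18)
defines no finite measure by itself — «This formula is still formal»). [cite: MagnenRivasseauSeneor1993, p.332 tl.24–26] -/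
theorem not_integrable_exp_half_quadSlices_muZero (ρ₁ : ℕ) {p₀ : Momentum} (hp : p₀ ∈ S)
    (hpn : p₀.neg ∈ S) (hκ : par.uvCutoff ρ₁ p₀.norm = 1) (hC₀ : 0 < par.invC0 ρ₁ p₀.norm)
    (hlam : ∀ i, 0 ≤ par.tentativeCoupling i) {μ₀ : Fin 4} (hμ₀ : μ₀ ≠ 0) (a₀ : Fin 3) :
    ¬ Integrable (fun A : Config => Real.exp ((1 / 2) * quadSlices S par ρ₁ A)) (muZero par ρ₁) := by
  intro h
  have hfin := h.hasFiniteIntegral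
  unfold HasFiniteIntegral at hfin
  have heq : ∫⁻ A, ‖Real.exp ((1 / 2) * quadSlices S par ρ₁ A)‖ₑ ∂(muZero par ρ₁) =
      ∫⁻ A, ENNReal.ofReal (Real.exp ((1 / 2) * quadSlices S par ρ₁ A)) ∂(muZero par ρ₁) :=
    lintegral_congr fun A => Real.enorm_eq_ofReal (Real.exp_nonneg _)
  rw [heq, lintegral_exp_half_quadSlices_muZero_eq_top S par ρ₁ hp hpn hκ hC₀ hlam hμ₀ a₀] at hfin
  exact lt_irrefl _ hfin

/-- The hypotheses of §7 are met by the print's own regime: below the plateau scale `|p₀| ≤ M^{ρ₁}` the fake cutoff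
is `1` (`Parameters.uvCutoff_eq_one_and_zero`), and windows are symmetric (`neg_mem_window_iff`); so on the
canonical window the positive exponential of (II.18) is non-integrable as soon as one mode with `|p₀| ≤ M^{ρ₁}`,
`|p₀| < R` and `C₀(p₀)⁻¹ > 0` exists. [cite: MagnenRivasseauSeneor1993, p.332 tl.24–26, (II.13)–(II.14) p.331] -/
theorem lintegral_exp_half_quadSlices_muZero_window_eq_top (ρ₁ : ℕ) {R : ℝ} {p₀ : Momentum}
    (hR : p₀.norm < R) (hplateau : p₀.norm ≤ (par.M : ℝ) ^ ρ₁) (hC₀ : 0 < par.invC0 ρ₁ p₀.norm)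
    (hlam : ∀ i, 0 ≤ par.tentativeCoupling i) {μ₀ : Fin 4} (hμ₀ : μ₀ ≠ 0) (a₀ : Fin 3) :
    ∫⁻ A, ENNReal.ofReal (Real.exp ((1 / 2) * quadSlices (window R) par ρ₁ A)) ∂(muZero par ρ₁) = ⊤ :=
  lintegral_exp_half_quadSlices_muZero_eq_top (window R) par ρ₁ ((mem_window_iff R p₀).mpr hR)
    ((neg_mem_window_iff R p₀).mpr ((mem_window_iff R p₀).mpr hR))
    ((par.uvCutoff_eq_one_and_zero ρ₁).1 hplateau) hC₀ hlam hμ₀ a₀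

/-- (v1.1) The unit spatial momentum `p = (0, 1, 0, 0)` — a plateau mode of every fake cutoff (`|p| = 1 ≤ M^{ρ₁}`).
[cite: MagnenRivasseauSeneor1993, §II.A p.328, (II.13)–(II.14) p.331] -/
def unitSpatial : Momentum := ⟨Pi.single 1 1, fun h => by simpa using congrFun h 1⟩

/-- `|(0,1,0,0)| = 1`. [cite: MagnenRivasseauSeneor1993, (II.13) p.331] -/
theorem unitSpatial_norm : unitSpatial.norm = 1 := by
  unfold Momentum.norm unitSpatial
  simp [Pi.single_apply]

/-- At `|p| = 1` the printed `C₀⁻¹` is positive as soon as the squared couplings are nonnegative and `(λ₀^t)² > 0`: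
`C₀(p)⁻¹ = Σ_{i≤ρ₁} (λ_i^t)² κ^i(1) ≥ (λ₀^t)² κ₀(1) = (λ₀^t)²` (`κ₀(1) = κ(1) = 1`, (II.14)).
[cite: MagnenRivasseauSeneor1993, (II.16) p.332, (II.14) p.331] -/
theorem Parameters.invC0_one_pos (ρ₁ : ℕ) (hlam : ∀ i, 0 ≤ par.tentativeCoupling i)
    (h0 : 0 < par.tentativeCoupling 0) : 0 < par.invC0 ρ₁ 1 := by
  unfold Parameters.invC0
  rw [one_pow, one_mul]
  have hM : (0 : ℝ) < par.M := by linarith [par.one_lt_M]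
  have hM1 : (1 : ℝ) ≤ par.M := par.one_lt_M.le
  have hκ : sliceCutoff par.τ par.η (par.M : ℝ) 0 1 = 1 := by
    rw [sliceCutoff_zero]
    exact scaledCutoff_eq_one par.τ par.η hM 0 (by simp)
  have hmem : 0 ∈ Finset.range (ρ₁ + 1) := by simp
  calc (0 : ℝ) < par.tentativeCoupling 0 * sliceCutoff par.τ par.η (par.M : ℝ) 0 1 := by
        rw [hκ, mul_one]; exact h0
    _ ≤ ∑ i ∈ Finset.range (ρ₁ + 1), par.tentativeCoupling i * sliceCutoff par.τ par.η (par.M : ℝ) i 1 :=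
        Finset.single_le_sum (f := fun i => par.tentativeCoupling i * sliceCutoff par.τ par.η (par.M : ℝ) i 1)
          (fun i _ => mul_nonneg (hlam i) (sliceCutoff_nonneg par.τ par.η (par.M : ℝ) par.hη hM1 i zero_le_one))
          hmem

/-- **(v1.1) p.332 tl.24–26 ON THE CANONICAL WINDOW, FOR EVERY FAKE CUTOFF `ρ₁`** — no mode-level hypothesis left: with
nonnegative squared couplings (II.12) and `(λ₀^t)² > 0` («C is a large constant»), the positive exponential of (II.18)
is not `dμ_{0,ρ₁}`-integrable on `window ((3 + η⁻¹)M^{ρ₁})` (the window of all modes `dμ_{0,ρ₁}` can excite): the unit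
spatial momentum is a plateau pair inside it. [cite: MagnenRivasseauSeneor1993, p.332 tl.24–26, (II.13)–(II.14) p.331, (II.18) p.332] -/
theorem lintegral_exp_half_quadSlices_muZero_canonical_eq_top (ρ₁ : ℕ)
    (hlam : ∀ i, 0 ≤ par.tentativeCoupling i) (h0 : 0 < par.tentativeCoupling 0) :
    ∫⁻ A, ENNReal.ofReal (Real.exp ((1 / 2) *
      quadSlices (window ((3 + par.η⁻¹) * (par.M : ℝ) ^ ρ₁)) par ρ₁ A)) ∂(muZero par ρ₁) = ⊤ := by
  have hM1 : (1 : ℝ) ≤ (par.M : ℝ) ^ ρ₁ := one_le_pow₀ par.one_lt_M.le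
  have hη : 0 < par.η⁻¹ := inv_pos.mpr par.hη
  refine lintegral_exp_half_quadSlices_muZero_window_eq_top par ρ₁ (p₀ := unitSpatial) ?_ ?_ ?_ hlam
    (μ₀ := 1) (by decide) 0
  · rw [unitSpatial_norm]; nlinarith
  · rw [unitSpatial_norm]; exact hM1
  · rw [unitSpatial_norm]; exact par.invC0_one_pos ρ₁ hlam h0

/-! ## §8 (v1.1) «The quadratic form p₀² is not invertible when p₀ = 0 and in order to have a good propagator we add
and subtract Σ_i(λ_i^t)²⟨A, p²κ^i(p)A⟩» (p.331 tl.18–19); «there remains a subgroup of the gauge group which acts still on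
the configurations satisfying (II.7), namely the gauge transformations independent of x₀» (p.329 tl.29–32) — the exact
ZERO MODES of the windowed free axial action, kernel-checked, and the positivity of `C_axial⁻¹` on them -/

/-- A single-colour LONGITUDINAL (linearised pure-gauge) configuration on the pair `±p`: `Ã^a_μ(±p) = (±p)_μ e^a w(±p)`
with `w(p) = u + iv`, `w(−p) = −u + iv` (so that `Ã(−p) = conj Ã(p)`: a REAL field), zero elsewhere — the Fourier
modes of `A_μ = ∂_μ φ` for a real `φ = e · φ₀ cos / sin (p·x)`; for `p₀ = 0` this is an infinitesimal TIME-INDEPENDENT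
abelian gauge transformation of `A = 0`, which the axial condition (II.7) does not fix (p.329 tl.29–32).
[cite: MagnenRivasseauSeneor1993, p.329 tl.29–32, (II.5) p.329] -/
def gaugeMode (p : Momentum) (e : Fin 3 → ℝ) (u v : ℝ) : Config := fun m =>
  if m.1 = p then ((p.1 m.2.1 : ℤ) : ℝ) * e m.2.2.1 * (if m.2.2.2 then v else u)
  else if m.1 = p.neg then ((p.neg.1 m.2.1 : ℤ) : ℝ) * e m.2.2.1 * (if m.2.2.2 then v else -u)
  else 0

/-- Its Fourier coefficients: `Ã^a_μ(q) = q_μ e^a w(q)` with `w(p) = u + iv`, `w(−p) = −u + iv`, `w = 0` otherwise.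
[cite: MagnenRivasseauSeneor1993, (II.5) p.329] -/
def gaugeWeight (p : Momentum) (u v : ℝ) (q : Momentum) : ℂ :=
  if q = p then (u : ℂ) + (v : ℂ) * I else if q = p.neg then -(u : ℂ) + (v : ℂ) * I else 0

/-- The coefficient formula. [cite: MagnenRivasseauSeneor1993, (II.5) p.329] -/
theorem coeff_gaugeMode (p : Momentum) (e : Fin 3 → ℝ) (u v : ℝ) (q : Momentum) (μ : Fin 4) (a : Fin 3) :
    coeff (gaugeMode p e u v) q μ a = ((q.1 μ : ℤ) : ℂ) * (e a : ℂ) * gaugeWeight p u v q := by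
  unfold coeff gaugeMode gaugeWeight
  by_cases h1 : q = p
  · subst h1
    simp only [if_true, Bool.false_eq_true, if_false]
    push_cast; ring
  · by_cases h2 : q = p.neg
    · subst h2
      have h3 : p.neg ≠ p := Momentum.neg_ne_self p
      simp only [h3, if_false, if_true, Bool.false_eq_true]
      push_cast; ring
    · simp only [h1, h2, if_false]
      push_cast; ring

/-- Hence `coeffZ` too is «momentum × fixed colour × scalar»: `Ã^a_μ(k) = k_μ e^a w_S(k)`.
[cite: MagnenRivasseauSeneor1993, (II.5) p.329] -/
theorem coeffZ_gaugeMode (p : Momentum) (e : Fin 3 → ℝ) (u v : ℝ) (k : Fin 4 → ℤ) :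
    ∃ w : ℂ, ∀ μ' a', coeffZ S (gaugeMode p e u v) k μ' a' = ((k μ' : ℤ) : ℂ) * (e a' : ℂ) * w := by
  unfold coeffZ
  by_cases hk : k = 0
  · exact ⟨0, fun μ' a' => by rw [dif_pos hk]; simp⟩
  · by_cases hmem : (⟨k, hk⟩ : Momentum) ∈ S
    · exact ⟨gaugeWeight p u v ⟨k, hk⟩, fun μ' a' => by
        rw [dif_neg hk, if_pos hmem, coeff_gaugeMode]⟩
    · exact ⟨0, fun μ' a' => by rw [dif_neg hk, if_neg hmem]; simp⟩

/-- The linear curvature of a longitudinal mode vanishes: `k_μ k_ν − k_ν k_μ = 0`.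
[cite: MagnenRivasseauSeneor1993, (II.1) p.328, p.329 tl.29–32] -/
theorem linCurv_gaugeMode (p : Momentum) (e : Fin 3 → ℝ) (u v : ℝ) (μ ν : Fin 4) (a : Fin 3) (k : Fin 4 → ℤ) :
    linCurv S (gaugeMode p e u v) μ ν a k = 0 := by
  obtain ⟨w, hw⟩ := coeffZ_gaugeMode S p e u v k
  unfold linCurv
  rw [hw, hw]
  ring

/-- The commutator term of a SINGLE-COLOUR configuration vanishes: `e ×₃ e = 0`.
[cite: MagnenRivasseauSeneor1993, (II.1) p.328 tl.33] -/
theorem quadCurv_gaugeMode (p : Momentum) (e : Fin 3 → ℝ) (u v : ℝ) (μ ν : Fin 4) (k : Fin 4 → ℤ) :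
    quadCurv S (gaugeMode p e u v) μ ν k = 0 := by
  unfold quadCurv
  refine Finset.sum_eq_zero fun q _ => Finset.sum_eq_zero fun r _ => ?_
  split_ifs
  · have h1 : (fun b => coeff (gaugeMode p e u v) q μ b) =
        (((q.1 μ : ℤ) : ℂ) * gaugeWeight p u v q) • fun b => (e b : ℂ) := by
      funext b; simp only [coeff_gaugeMode, Pi.smul_apply, smul_eq_mul]; ring
    have h2 : (fun c => coeff (gaugeMode p e u v) r ν c) =
        (((r.1 ν : ℤ) : ℂ) * gaugeWeight p u v r) • fun c => (e c : ℂ) := by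
      funext c; simp only [coeff_gaugeMode, Pi.smul_apply, smul_eq_mul]; ring
    rw [h1, h2, LinearMap.map_smul₂, LinearMap.map_smul, cross_self, smul_zero, smul_zero]
  · rfl

/-- So the FULL windowed curvature of the longitudinal single-colour mode vanishes, for every coupling.
[cite: MagnenRivasseauSeneor1993, (II.1) p.328, p.329 tl.29–32] -/
theorem curvCoeff_gaugeMode (lam : ℝ) (p : Momentum) (e : Fin 3 → ℝ) (u v : ℝ) (μ ν : Fin 4) (a : Fin 3)
    (k : Fin 4 → ℤ) : curvCoeff S lam (gaugeMode p e u v) μ ν a k = 0 := by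
  unfold curvCoeff
  rw [linCurv_gaugeMode, quadCurv_gaugeMode]
  simp

/-- **ZERO MODE of the action**: the Yang–Mills action (II.2) of the longitudinal single-colour mode is `0` on every
window, for every coupling. [cite: MagnenRivasseauSeneor1993, (II.2) p.328, p.329 tl.29–32] -/
theorem action_gaugeMode (lam : ℝ) (p : Momentum) (e : Fin 3 → ℝ) (u v : ℝ) :
    action S lam (gaugeMode p e u v) = 0 := by
  unfold action
  simp [curvCoeff_gaugeMode]

/-- … in particular its quadratic piece `F₂` vanishes there. [cite: MagnenRivasseauSeneor1993, (II.3) p.329] -/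
theorem F2_gaugeMode (p : Momentum) (e : Fin 3 → ℝ) (u v : ℝ) : F2 S (gaugeMode p e u v) = 0 := by
  rw [← action_zero, action_gaugeMode]

/-- For a TIME-INDEPENDENT mode (`p₀ = 0`) the configuration is axial (II.7) …
[cite: MagnenRivasseauSeneor1993, (II.7) p.329, p.329 tl.29–32] -/
theorem isAxial_gaugeMode {p : Momentum} (hp0 : p.1 0 = 0) (e : Fin 3 → ℝ) (u v : ℝ) :
    IsAxial (gaugeMode p e u v) := by
  rintro ⟨q, μ, a, b⟩ hm
  change μ = 0 at hm
  subst hm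
  unfold gaugeMode
  simp [hp0]

/-- … and «the quadratic form p₀²» vanishes on it: `⟨A, p₀²A⟩ = 0`.
[cite: MagnenRivasseauSeneor1993, p.331 tl.18] -/
theorem quadTime_gaugeMode {p : Momentum} (hp0 : p.1 0 = 0) (e : Fin 3 → ℝ) (u v : ℝ) :
    quadTime S (gaugeMode p e u v) = 0 := by
  unfold quadTime
  rw [mul_eq_zero]
  right
  refine Finset.sum_eq_zero fun q _ => ?_
  by_cases h1 : q = p
  · subst h1; simp [hp0]
  · by_cases h2 : q = p.neg
    · subst h2; simp [hp0]
    · have : ∀ μ a, coeff (gaugeMode p e u v) q μ a = 0 := fun μ a => by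
        rw [coeff_gaugeMode]; unfold gaugeWeight; rw [if_neg h1, if_neg h2]; simp
      simp [this]

/-- The mode is NOT the zero configuration (for `e ≠ 0`, `(u, v) ≠ (0, 0)`; `p ≠ 0` always).
[cite: MagnenRivasseauSeneor1993, p.329 tl.29–32] -/
theorem gaugeMode_ne_zero (p : Momentum) {e : Fin 3 → ℝ} (he : e ≠ 0) {u v : ℝ} (huv : u ≠ 0 ∨ v ≠ 0) :
    gaugeMode p e u v ≠ 0 := by
  obtain ⟨a, ha⟩ : ∃ a, e a ≠ 0 := by
    by_contra h
    exact he (funext fun a => not_not.mp (not_exists.mp h a))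
  obtain ⟨μ, hμ⟩ : ∃ μ, p.1 μ ≠ 0 := by
    by_contra h
    exact p.2 (funext fun μ => not_not.mp (not_exists.mp h μ))
  have hμ' : ((p.1 μ : ℤ) : ℝ) ≠ 0 := by exact_mod_cast hμ
  intro h0
  rcases huv with hu | hv
  · have := congrFun h0 (p, μ, a, false)
    simp only [gaugeMode, if_true, Bool.false_eq_true, if_false, Pi.zero_apply, mul_eq_zero] at this
    rcases this with (h | h) | h
    · exact hμ' h
    · exact ha h
    · exact hu h
  · have := congrFun h0 (p, μ, a, true)
    simp only [gaugeMode, if_true, Pi.zero_apply, mul_eq_zero] at this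
    rcases this with (h | h) | h
    · exact hμ' h
    · exact ha h
    · exact hv h

/-- It is supported on the pair `±p` (so inside any window containing that pair: a zero mode OF THE WINDOWED action,
not an artefact of modes the window ignores). [cite: MagnenRivasseauSeneor1993, p.329 tl.29–32] -/
theorem gaugeMode_support (p : Momentum) (e : Fin 3 → ℝ) (u v : ℝ) {m : Mode} (hm : gaugeMode p e u v m ≠ 0) :
    m.1 = p ∨ m.1 = p.neg := by
  unfold gaugeMode at hm
  by_contra h
  rw [not_or] at h
  rw [if_neg h.1, if_neg h.2] at hm
  exact hm rfl

/-- **p.331 tl.18 / p.329 tl.29–32 KERNEL-CHECKED.** On any window containing a time-independent pair `±p` (`p₀ = 0`)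
the FREE AXIAL ACTION `F₂ = ⟨A,p₀²A⟩ + F_{2,sp}` (`F2_eq_quadTime_add_F2sp`) — indeed the full action for every
coupling — has a nonzero axial ZERO MODE supported inside the window: the quadratic form of the axial-gauge ansatz is
NOT definite («p₀² is not invertible when p₀ = 0»; the residual time-independent gauge transformations).
[cite: MagnenRivasseauSeneor1993, p.331 tl.18–19, p.329 tl.29–32] -/
theorem exists_axial_zeroMode {p : Momentum} (hp0 : p.1 0 = 0) :
    ∃ A : Config, IsAxial A ∧ A ≠ 0 ∧ (∀ m, A m ≠ 0 → m.1 = p ∨ m.1 = p.neg) ∧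
      quadTime S A = 0 ∧ F2 S A = 0 ∧ ∀ lam, action S lam A = 0 := by
  refine ⟨gaugeMode p (fun _ => 1) 1 0, isAxial_gaugeMode hp0 _ _ _,
    gaugeMode_ne_zero p (fun h => ?_) (Or.inl one_ne_zero), fun m hm => gaugeMode_support p _ _ _ hm,
    quadTime_gaugeMode S hp0 _ _ _, F2_gaugeMode S p _ _ _, fun lam => action_gaugeMode S lam p _ _ _⟩
  have := congrFun h 0
  simp at this

/-- **… and the added term cures it** («in order to have a good propagator we add and subtract Σ_i(λ_i^t)²⟨A,
p²κ^i(p)A⟩»): on the zero mode `C_axial⁻¹ = p₀² + C₀⁻¹` is POSITIVE as soon as `C₀(p)⁻¹ > 0` —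
`⟨A, p₀²A⟩ + Σ_i(λ_i^t)²⟨A, p²κ^iA⟩ = C₀(p)⁻¹ |p|² |e|² (u² + v²) > 0`. [cite: MagnenRivasseauSeneor1993, p.331 tl.18–19, (II.19) p.332] -/
theorem quadTime_add_quadSlices_gaugeMode_pos (ρ₁ : ℕ) {p : Momentum} (hp : p ∈ S) (hp0 : p.1 0 = 0)
    (hlam : ∀ i, 0 ≤ par.tentativeCoupling i) (hC₀ : 0 < par.invC0 ρ₁ p.norm)
    {e : Fin 3 → ℝ} (he : e ≠ 0) {u v : ℝ} (huv : u ≠ 0 ∨ v ≠ 0) :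
    0 < quadTime S (gaugeMode p e u v) + quadSlices S par ρ₁ (gaugeMode p e u v) := by
  classical
  rw [quadTime_gaugeMode S hp0, zero_add, quadSlices_eq_invC0]
  unfold quadForm
  refine mul_pos (by norm_num) ?_
  -- the term at `p` alone is positive; all terms are nonnegative
  have hnn : ∀ q ∈ S, 0 ≤ par.invC0 ρ₁ q.norm * ∑ μ, ∑ a, normSq (coeff (gaugeMode p e u v) q μ a) :=
    fun q _ => mul_nonneg (par.invC0_nonneg' ρ₁ hlam q.norm_nonneg)
      (Finset.sum_nonneg fun _ _ => Finset.sum_nonneg fun _ _ => normSq_nonneg _)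
  refine lt_of_lt_of_le ?_ (Finset.single_le_sum hnn hp)
  refine mul_pos hC₀ ?_
  obtain ⟨a, ha⟩ : ∃ a, e a ≠ 0 := by
    by_contra h
    exact he (funext fun a => not_not.mp (not_exists.mp h a))
  obtain ⟨μ, hμ⟩ : ∃ μ, p.1 μ ≠ 0 := by
    by_contra h
    exact p.2 (funext fun μ => not_not.mp (not_exists.mp h μ))
  have hterm : 0 < normSq (coeff (gaugeMode p e u v) p μ a) := by
    rw [normSq_pos, coeff_gaugeMode]
    unfold gaugeWeight
    rw [if_pos rfl]
    refine mul_ne_zero (mul_ne_zero ?_ ?_) ?_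
    · exact_mod_cast hμ
    · exact_mod_cast ha
    · intro h
      have hre := congrArg Complex.re h
      have him := congrArg Complex.im h
      simp at hre him
      rcases huv with hu | hv
      · exact hu hre
      · exact hv him
  refine lt_of_lt_of_le ?_ (Finset.single_le_sum (f := fun μ => ∑ a, normSq (coeff (gaugeMode p e u v) p μ a))
    (fun _ _ => Finset.sum_nonneg fun _ _ => normSq_nonneg _) (Finset.mem_univ μ))
  exact lt_of_lt_of_le hterm (Finset.single_le_sum (f := fun a => normSq (coeff (gaugeMode p e u v) p μ a))
    (fun _ _ => normSq_nonneg _) (Finset.mem_univ a))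

/-! ## §9 (v1.1) (II.9) at the level of the INTEGRAND — convention-free cross-check on pointwise jets
(`SectIV.FieldJet`, `SectIV.curvature` = (II.1) of `…MRS93CurvatureDecomposition`, seat mrs-lit-2) -/

section jet

open SectIV TruncatedGauge

/-- `[0, Y] = 0` for the printed wedge product on `ℝ³`. [cite: MagnenRivasseauSeneor1993, §II.A p.328 tl.33] -/
theorem bracket_zero_left (Y : Fin 3 → ℝ) : bracket 0 Y = 0 := by
  funext a
  simp [bracket]

/-- In the axial gauge the integrand of `F_{0n}` is `∂₀A_n`: `F^a_{0ν} = ∂₀A^a_ν` when `A₀ = 0` (hence `∂_νA₀ = 0`).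
[cite: MagnenRivasseauSeneor1993, (II.1) p.328, (II.7) p.329] -/
theorem curvature_time_left_axial (lam : ℝ) (J : FieldJet) (h0 : J.val 0 = 0) (hd : ∀ ν, J.der ν 0 = 0)
    (ν : Fin 4) : curvature lam J 0 ν = J.der 0 ν := by
  unfold curvature
  rw [hd, h0, bracket_zero_left, smul_zero, sub_zero, sub_zero]

/-- **(II.9) for the integrand (convention-free).** At a point where `A₀ = 0` and `∂_νA₀ = 0` (the axial gauge (II.7)),
`Σ_{μ,ν} Σ_a (F^a_μν)² = 2 Σ_n Σ_a (∂₀A^a_n)² + Σ_{m,n} Σ_a (F^a_mn)²` (spatial `m, n`); integrating `(1/4)∫_Λ d⁴x` of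
this identity gives `(1/2)∫F² = (1/2)Σ_{n,a}∫(∂₀A^a_n)² + F_sp`, and `(1/2)Σ_{n,a}∫(∂₀A^a_n)² = ⟨A, p₀²A⟩` by Parseval —
the position-space face of `action_eq_quadTime_add_Fsp` and of READING (Q).
[cite: MagnenRivasseauSeneor1993, (II.9)–(II.10) p.330 tl.6–9] -/
theorem curvature_sq_axial_split (lam : ℝ) (J : FieldJet) (h0 : J.val 0 = 0) (hd : ∀ ν, J.der ν 0 = 0) :
    ∑ μ, ∑ ν, ∑ a, curvature lam J μ ν a ^ 2 =
      2 * ∑ n : Fin 3, ∑ a, J.der 0 n.succ a ^ 2 +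
        ∑ m : Fin 3, ∑ n : Fin 3, ∑ a, curvature lam J m.succ n.succ a ^ 2 := by
  rw [sum_fin4_fin4_split (fun μ ν => ∑ a, curvature lam J μ ν a ^ 2)]
  have h00 : ∑ a, curvature lam J 0 0 a ^ 2 = 0 := by
    simp [curvature_time_left_axial lam J h0 hd 0, hd 0]
  have h0n : ∀ n : Fin 3, ∑ a, curvature lam J 0 n.succ a ^ 2 = ∑ a, J.der 0 n.succ a ^ 2 := fun n => by
    simp [curvature_time_left_axial lam J h0 hd]
  have hn0 : ∀ m : Fin 3, ∑ a, curvature lam J m.succ 0 a ^ 2 = ∑ a, J.der 0 m.succ a ^ 2 := fun m => by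
    simp [curvature_antisymm lam J 0 m.succ, curvature_time_left_axial lam J h0 hd]
  simp only [h00, h0n, hn0, zero_add]
  ring

end jet

/-! ## §10 (v1.2) «which is proportional to dμ_{axial,ρ₁}(A) … the Gaussian measure dμ_axial and propagators C_axial
are obtained by joining to C₀ the quadratic piece ⟨A, p₀²A⟩» (p.332 tl.18–23, (II.18)–(II.19)) — ONE MODE, kernel-checked:
tilting a centred Gaussian coordinate by `e^{−c x²/2}` is, up to the constant `√(v'/v)`, the centred Gaussian with
`v'⁻¹ = v⁻¹ + c` -/

/-- **Gaussian tilting, one real mode.** For `v ≠ 0`, `c ≥ 0` and `v'` with `v'⁻¹ = v⁻¹ + c`: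
`𝒩(0,v) · e^{−c x²/2} = √(v'/v) · 𝒩(0,v')` as measures — the one-coordinate content of «joining to C₀ the quadratic
piece» (density `(2πv)^{−1/2}e^{−x²/2v}e^{−cx²/2} = √(v'/v)(2πv')^{−1/2}e^{−x²/2v'}`).
[cite: MagnenRivasseauSeneor1993, (II.18)–(II.19) p.332 tl.18–23] -/
theorem gaussianReal_withDensity_exp_neg_half_mul_sq {v v' : ℝ≥0} (hv : v ≠ 0) {c : ℝ} (hc : 0 ≤ c)
    (hv' : (v' : ℝ) = (((v : ℝ))⁻¹ + c)⁻¹) :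
    (gaussianReal 0 v).withDensity (fun x => ENNReal.ofReal (Real.exp (-(c / 2) * x ^ 2))) =
      ENNReal.ofReal (Real.sqrt (v' / v)) • gaussianReal 0 v' := by
  have hvpos : (0 : ℝ) < v := lt_of_le_of_ne v.2 (fun h => hv (by exact_mod_cast h.symm))
  have hsum : (0 : ℝ) < (v : ℝ)⁻¹ + c := by positivity
  have hv'pos : (0 : ℝ) < v' := by rw [hv']; exact inv_pos.mpr hsum
  have hv'0 : v' ≠ 0 := by
    intro h; rw [h, NNReal.coe_zero] at hv'pos; exact lt_irrefl _ hv'pos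
  have hmeas : Measurable fun x : ℝ => ENNReal.ofReal (Real.exp (-(c / 2) * x ^ 2)) := by fun_prop
  rw [gaussianReal_of_var_ne_zero 0 hv, gaussianReal_of_var_ne_zero 0 hv'0,
    ← withDensity_mul _ (measurable_gaussianPDF 0 v) hmeas,
    ← withDensity_smul _ (measurable_gaussianPDF 0 v')]
  congr 1
  funext x
  simp only [Pi.mul_apply, Pi.smul_apply, smul_eq_mul, gaussianPDF, gaussianPDFReal]
  rw [← ENNReal.ofReal_mul (mul_nonneg (inv_nonneg.mpr (Real.sqrt_nonneg _)) (Real.exp_nonneg _)),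
    ← ENNReal.ofReal_mul (Real.sqrt_nonneg _)]
  congr 1
  have hexp : Real.exp (-(x - 0) ^ 2 / (2 * (v : ℝ))) * Real.exp (-(c / 2) * x ^ 2) =
      Real.exp (-(x - 0) ^ 2 / (2 * (v' : ℝ))) := by
    rw [← Real.exp_add]
    congr 1
    rw [hv']
    field_simp
    ring
  have hconst : (Real.sqrt (2 * Real.pi * v))⁻¹ =
      Real.sqrt (v' / v) * (Real.sqrt (2 * Real.pi * v'))⁻¹ := by
    rw [← Real.sqrt_inv, ← Real.sqrt_inv, ← Real.sqrt_mul (div_nonneg hv'pos.le hvpos.le)]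
    congr 1
    field_simp
  rw [mul_assoc, hexp, hconst, mul_assoc]

/-- **(II.19) as a MEASURE, one mode of the pinned carrier.** For a spatial coordinate `m = (p, μ, a, ·)` (`μ ≠ 0`) on
the plateau of the fake cutoff (`κ_{ρ₁}(|p|) = 1`) with `C₀(p)⁻¹ > 0`: the mode law `𝒩(0, C₀(p))` of `dμ_{0,ρ₁}` tilted
by its share `e^{−p₀² x²/2}` of `e^{−(1/2)⟨A,p₀²A⟩}` is `√(C_axial/C₀) · 𝒩(0, C_axial(p))` with `C_axial(p)⁻¹ = p₀² +
C₀(p)⁻¹` — the printed `⟨A, C_axial⁻¹A⟩ = ⟨A, p₀²A⟩ + Σ_i(λ_i^t)²⟨Ap²κ^i(p)A⟩` (II.19), i.e. `dμ_{0,ρ₁}(A)e^{−(1/2)⟨A,p₀²A⟩} ∝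
dμ_{axial,ρ₁}(A)` MODE BY MODE. (The assembly over all modes of the window — a finite product of such tilts times the
untouched modes — is not carried out here.) [cite: MagnenRivasseauSeneor1993, (II.18)–(II.19) p.332 tl.16–23] -/
theorem muZeroVariance_tilt_eq_axial (ρ₁ : ℕ) {m : Mode} (hμ : ¬ m.IsTime) (hκ : par.uvCutoff ρ₁ m.1.norm = 1)
    (hC₀ : 0 < par.invC0 ρ₁ m.1.norm) {v' : ℝ≥0}
    (hv' : (v' : ℝ) = (((m.1.1 0 : ℤ) : ℝ) ^ 2 + par.invC0 ρ₁ m.1.norm)⁻¹) :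
    (gaussianReal 0 (par.muZeroVariance ρ₁ m)).withDensity
        (fun x => ENNReal.ofReal (Real.exp (-(((m.1.1 0 : ℤ) : ℝ) ^ 2 / 2) * x ^ 2))) =
      ENNReal.ofReal (Real.sqrt (v' / par.muZeroVariance ρ₁ m)) • gaussianReal 0 v' := by
  have hv : ((par.muZeroVariance ρ₁ m : ℝ≥0) : ℝ) = (par.invC0 ρ₁ m.1.norm)⁻¹ := by
    unfold Parameters.muZeroVariance
    rw [if_neg hμ]
    unfold Parameters.muZeroCovariance
    rw [hκ, one_mul, Real.coe_toNNReal _ (inv_nonneg.mpr hC₀.le)]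
  have hv0 : par.muZeroVariance ρ₁ m ≠ 0 := by
    intro h
    rw [h, NNReal.coe_zero] at hv
    exact (inv_pos.mpr hC₀).ne' hv.symm
  refine gaussianReal_withDensity_exp_neg_half_mul_sq hv0 (sq_nonneg _) ?_
  rw [hv', hv, inv_inv, add_comm]

end MainStatement

end Literature.MathematicalPhysics.QuantumFieldTheory.MagnenRivasseauSeneor1993
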